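import Summits.QuantumFields.YangMills.Theses.FlowLineStateSpace

/-!
# Line `anomaly-split` — crux stmt-QuantumFields-9118 `FlowLineStateSpace.CurvatureNonGaussianity`
# (crux-strategist BC2-redirect decomposition; planner-cstrat-stmt-QuantumFields-9118-r1-0, 2026-08-17)

TRACE-ANOMALY DICHOTOMY. The crux (non-vanishing of some off-diagonal three-point functional of the renormalised curvature
field along every scheme with (VS), (UVB), (ND), (CL)) is decomposed into three typed pieces — the route's future children
(glue `Cruxes/CurvatureNonGaussianity/Split.lean`, `curvatureNonGaussianity_of_subs : A → B → C → CurvatureNonGaussianity`,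
sorry-free):

* `AnomalyInsertionLocality` (A) — the integrated third insertion = universal renormalisation + separated insertions (OPE core),
* `CouplingDerivativeTransmutation` (B) — the coupling derivative of the two-point functional is not a renormalisation
  (dimensional transmutation; a pure two-point statement),
* `NonGaussianityOffScaling` (C) — the crux outside the (AF ∧ uniformly clustering) regime (scope piece).

Mechanism: the exact lattice identity `∂_β ⟨φ_x φ_y⟩_β = Cov_β(φ_x φ_y, Σ_z F_z)` (action insertion) turns the β-function / trace
anomaly into a handle on the THREE-point function from TWO-point data; arguing by contradiction, the vanishing of every
off-diagonal three-point functional would make the anomaly insertion `D_k(F) := c_k a_k⁴ ∂_b LS_b(k,2,F)|_(β_k)` asymptotically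
proportional to the two-point functional (A), which dimensional transmutation forbids (B). The only UV input left is the
contact structure (stub `ContactLocality`).

Layout: §0 abstract assembly lemmas; §1 the pieces (local copies, verbatim the children statements); §2 the six OBLIGATIONS as
named `def`s; §3 the registered stubs `Stub.<Name> : <signature> := by sorry` (sorry only there; stub signatures are `:=`-free: instance binders `[MeasurableSpace G] [BorelSpace G]` and the functionals `LS`, `LSb`, `D` as arguments with defining equations — instantiated by `rfl` from the pieces' `letI`/`let` forms); §4 compositions per piece;
§5 `CurvatureNonGaussianity_of : InsertionIdentityFar → … → NonGaussianityOffAF → CurvatureNonGaussianity` (route decl BY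
NAME) and `CurvatureNonGaussianity_proof`. References: Lüscher 2010 (arXiv:1006.4518), Lüscher–Weisz 2011 (arXiv:1101.0963),
Suzuki 2013 (arXiv:1304.0533), Osterwalder–Schrader 1975, Osterwalder–Seiler 1978, 't Hooft 1976, Bhanot–Creutz 1981.
-/

open Filter Topology

namespace Summit.QuantumFields.YangMills.Cruxes.CurvatureNonGaussianity.AnomalySplit

/-! ## §0 Abstract assembly lemmas (pure filter / inequality logic over opaque functionals) -/

/-- Dichotomy core: locality (A-shape) and non-proportionality (B-shape) force a non-vanishing off-diagonal
three-point functional. [folklore] -/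
theorem anomaly_dichotomy {σ ι₂ ι₃ : Type*}
    {Tens₂ : ι₂ → σ → σ → Prop} {Off₂ : ι₂ → Prop} {Cpt : σ → Prop}
    {Tens₃ : ι₃ → σ → σ → σ → Prop} {Off₃ : ι₃ → Prop}
    {W : ℕ → ι₂ → ℂ} {T : ℕ → ι₃ → ℂ} {D : ℕ → ι₂ → ℂ}
    (hA : ∃ d : ℝ → ℕ → ℂ, ∀ (f g : σ) (F : ι₂), Tens₂ F f g → Off₂ F → Cpt f → Cpt g →
      ∀ ε : ℝ, 0 < ε → ∃ ρ₀ : ℝ, 0 < ρ₀ ∧ ∀ ρ : ℝ, 0 < ρ → ρ < ρ₀ →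
        ∃ (N : ℕ) (H' : Fin N → ι₃), (∀ j, ∃ (f' g' h' : σ), Tens₃ (H' j) f' g' h' ∧ Off₃ (H' j)) ∧
          ∀ᶠ k in atTop, ‖D k F - ∑ j, T k (H' j) - d ρ k * W k F‖ ≤ ε)
    (hB : ∃ (f₁ g₁ f₂ g₂ : σ) (F₁ F₂ : ι₂), Tens₂ F₁ f₁ g₁ ∧ Tens₂ F₂ f₂ g₂ ∧ Off₂ F₁ ∧ Off₂ F₂ ∧
      Cpt f₁ ∧ Cpt g₁ ∧ Cpt f₂ ∧ Cpt g₂ ∧ ∃ δ : ℝ, 0 < δ ∧ ∀ d : ℕ → ℂ,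
        ∃ᶠ k in atTop, δ ≤ ‖D k F₁ - d k * W k F₁‖ + ‖D k F₂ - d k * W k F₂‖) :
    ∃ (f g h : σ) (F₃ : ι₃), Tens₃ F₃ f g h ∧ Off₃ F₃ ∧ ∃ δ : ℝ, 0 < δ ∧
      ∃ᶠ k in atTop, δ ≤ ‖T k F₃‖ := by
  by_contra hNG
  -- negation: every off-diagonal pure three-tensor has an asymptotically vanishing functional
  have hvan : ∀ (H : ι₃), (∃ (f' g' h' : σ), Tens₃ H f' g' h' ∧ Off₃ H) →
      ∀ δ : ℝ, 0 < δ → ∀ᶠ k in atTop, ‖T k H‖ < δ := by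
    intro H ⟨f', g', h', hT, hO⟩ δ hδ
    by_contra hne
    apply hNG
    refine ⟨f', g', h', H, hT, hO, δ, hδ, ?_⟩
    rw [Filter.not_eventually] at hne
    exact hne.mono fun k hk => not_lt.mp hk
  obtain ⟨d, hd⟩ := hA
  obtain ⟨f₁, g₁, f₂, g₂, F₁, F₂, hT₁, hT₂, hO₁, hO₂, hf₁, hg₁, hf₂, hg₂, δ, hδ, hBd⟩ := hB
  -- finite off-diagonal families have eventually small total functional
  have hfam : ∀ (N : ℕ) (H' : Fin N → ι₃), (∀ j, ∃ (f' g' h' : σ), Tens₃ (H' j) f' g' h' ∧ Off₃ (H' j)) →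
      ∀ η : ℝ, 0 < η → ∀ᶠ k in atTop, ‖∑ j, T k (H' j)‖ ≤ η := by
    intro N H' hH' η hη
    have hη' : 0 < η / (N + 1) := by positivity
    have hall : ∀ᶠ k in atTop, ∀ j, ‖T k (H' j)‖ < η / (N + 1) :=
      Filter.eventually_all.2 fun j => hvan (H' j) (hH' j) _ hη'
    refine hall.mono fun k hk => ?_
    calc ‖∑ j, T k (H' j)‖ ≤ ∑ j, ‖T k (H' j)‖ := norm_sum_le _ _
      _ ≤ ∑ _j : Fin N, η / (N + 1) := Finset.sum_le_sum fun j _ => (hk j).le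
      _ = N * (η / (N + 1)) := by simp
      _ ≤ η := by
          rw [mul_div_assoc']
          rw [div_le_iff₀ (by positivity)]
          nlinarith
  -- apply piece A to both tensors with ε = δ/4
  have hδ4 : 0 < δ / 4 := by positivity
  obtain ⟨ρ₁, hρ₁, h₁⟩ := hd f₁ g₁ F₁ hT₁ hO₁ hf₁ hg₁ (δ / 4) hδ4
  obtain ⟨ρ₂, hρ₂, h₂⟩ := hd f₂ g₂ F₂ hT₂ hO₂ hf₂ hg₂ (δ / 4) hδ4
  set ρ : ℝ := min ρ₁ ρ₂ / 2 with hρdef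
  have hρpos : 0 < ρ := by positivity
  have hρlt₁ : ρ < ρ₁ := by
    have := min_le_left ρ₁ ρ₂
    rw [hρdef]; linarith
  have hρlt₂ : ρ < ρ₂ := by
    have := min_le_right ρ₁ ρ₂
    rw [hρdef]; linarith
  obtain ⟨N₁, H₁, hH₁, hev₁⟩ := h₁ ρ hρpos hρlt₁
  obtain ⟨N₂, H₂, hH₂, hev₂⟩ := h₂ ρ hρpos hρlt₂
  have hδ8 : 0 < δ / 8 := by positivity
  have hs₁ := hfam N₁ H₁ hH₁ (δ / 8) hδ8
  have hs₂ := hfam N₂ H₂ hH₂ (δ / 8) hδ8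
  -- eventually the deviation from proportionality is < δ
  have hsmall : ∀ᶠ k in atTop,
      ‖D k F₁ - d ρ k * W k F₁‖ + ‖D k F₂ - d ρ k * W k F₂‖ < δ := by
    filter_upwards [hev₁, hev₂, hs₁, hs₂] with k hk₁ hk₂ hk₃ hk₄
    have e₁ : D k F₁ - d ρ k * W k F₁ =
        (D k F₁ - ∑ j, T k (H₁ j) - d ρ k * W k F₁) + ∑ j, T k (H₁ j) := by ring
    have e₂ : D k F₂ - d ρ k * W k F₂ =
        (D k F₂ - ∑ j, T k (H₂ j) - d ρ k * W k F₂) + ∑ j, T k (H₂ j) := by ring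
    have b₁ : ‖D k F₁ - d ρ k * W k F₁‖ ≤ δ / 4 + δ / 8 := by
      rw [e₁]; exact (norm_add_le _ _).trans (add_le_add hk₁ hk₃)
    have b₂ : ‖D k F₂ - d ρ k * W k F₂‖ ≤ δ / 4 + δ / 8 := by
      rw [e₂]; exact (norm_add_le _ _).trans (add_le_add hk₂ hk₄)
    linarith
  -- while piece B says it is frequently ≥ δ
  obtain ⟨k, hk, hk'⟩ := (hsmall.and_frequently (hBd (d ρ))).exists
  exact absurd hk' (not_le.mpr hk)

/-- Running + non-homogeneity ⇒ non-proportionality (core of `CouplingDerivativeTransmutation_of`). [folklore] -/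
theorem transmutation_assembly {ι : Type*} {W D : ℕ → ι → ℂ} {F₁ F₂ Fd₁ Fd₂ : ι}
    {κ κ' : ℕ → ℂ} {κ₀ δ' M : ℝ} (hκ₀ : 0 < κ₀) (hδ' : 0 < δ')
    (hκev : ∀ᶠ k in atTop, κ₀ ≤ ‖κ k‖)
    (hM : ∀ᶠ k in atTop, ‖W k F₁‖ ≤ M ∧ ‖W k F₂‖ ≤ M)
    (hdet : ∃ᶠ k in atTop, δ' ≤ ‖W k Fd₁ * W k F₂ - W k Fd₂ * W k F₁‖)
    (hr₁ : Tendsto (fun k => D k F₁ - κ k * W k Fd₁ - κ' k * W k F₁) atTop (𝓝 0))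
    (hr₂ : Tendsto (fun k => D k F₂ - κ k * W k Fd₂ - κ' k * W k F₂) atTop (𝓝 0)) :
    ∃ δ : ℝ, 0 < δ ∧ ∀ d : ℕ → ℂ,
      ∃ᶠ k in atTop, δ ≤ ‖D k F₁ - d k * W k F₁‖ + ‖D k F₂ - d k * W k F₂‖ := by
  set Mp : ℝ := max M 0 + 1 with hMp_def
  have hMp : 0 < Mp := by positivity
  have hMle : M ≤ Mp := by
    have := le_max_left M 0
    linarith
  refine ⟨κ₀ * δ' / (2 * Mp), by positivity, fun d => ?_⟩
  have hη : 0 < κ₀ * δ' / (4 * Mp) := by positivity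
  have he₁ : ∀ᶠ k in atTop, ‖D k F₁ - κ k * W k Fd₁ - κ' k * W k F₁‖ ≤ κ₀ * δ' / (4 * Mp) :=
    (Metric.tendsto_nhds.1 hr₁ _ hη).mono fun k hk => by
      simpa only [dist_zero_right] using hk.le
  have he₂ : ∀ᶠ k in atTop, ‖D k F₂ - κ k * W k Fd₂ - κ' k * W k F₂‖ ≤ κ₀ * δ' / (4 * Mp) :=
    (Metric.tendsto_nhds.1 hr₂ _ hη).mono fun k hk => by
      simpa only [dist_zero_right] using hk.le
  refine (hdet.and_eventually (hκev.and (hM.and (he₁.and he₂)))).mono ?_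
  rintro k ⟨hdk, hκk, ⟨hW₁, hW₂⟩, hek₁, hek₂⟩
  -- abbreviations
  set W₁ := W k F₁
  set W₂ := W k F₂
  set V₁ := W k Fd₁
  set V₂ := W k Fd₂
  set X₁ := D k F₁ - d k * W₁
  set X₂ := D k F₂ - d k * W₂
  set E₁ := D k F₁ - κ k * V₁ - κ' k * W₁
  set E₂ := D k F₂ - κ k * V₂ - κ' k * W₂
  have hid : κ k * (V₁ * W₂ - V₂ * W₁) = (X₁ * W₂ - X₂ * W₁) - (E₁ * W₂ - E₂ * W₁) := by
    simp only [X₁, X₂, E₁, E₂]; ring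
  have hW₁' : ‖W₁‖ ≤ Mp := hW₁.trans hMle
  have hW₂' : ‖W₂‖ ≤ Mp := hW₂.trans hMle
  have key : κ₀ * δ' ≤ (‖X₁‖ + ‖X₂‖) * Mp + (‖E₁‖ + ‖E₂‖) * Mp := by
    calc κ₀ * δ' ≤ ‖κ k‖ * ‖V₁ * W₂ - V₂ * W₁‖ :=
          mul_le_mul hκk hdk hδ'.le (norm_nonneg _)
      _ = ‖(X₁ * W₂ - X₂ * W₁) - (E₁ * W₂ - E₂ * W₁)‖ := by rw [← norm_mul, hid]
      _ ≤ ‖X₁ * W₂ - X₂ * W₁‖ + ‖E₁ * W₂ - E₂ * W₁‖ := norm_sub_le _ _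
      _ ≤ (‖X₁‖ * ‖W₂‖ + ‖X₂‖ * ‖W₁‖) + (‖E₁‖ * ‖W₂‖ + ‖E₂‖ * ‖W₁‖) :=
          add_le_add ((norm_sub_le _ _).trans (add_le_add (norm_mul_le _ _) (norm_mul_le _ _)))
            ((norm_sub_le _ _).trans (add_le_add (norm_mul_le _ _) (norm_mul_le _ _)))
      _ ≤ (‖X₁‖ + ‖X₂‖) * Mp + (‖E₁‖ + ‖E₂‖) * Mp := by
          nlinarith [norm_nonneg X₁, norm_nonneg X₂, norm_nonneg E₁, norm_nonneg E₂,
            norm_nonneg W₁, norm_nonneg W₂]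
  have hE : (‖E₁‖ + ‖E₂‖) * Mp ≤ κ₀ * δ' / 2 := by
    have h2 : ‖E₁‖ + ‖E₂‖ ≤ 2 * (κ₀ * δ' / (4 * Mp)) := by linarith
    calc (‖E₁‖ + ‖E₂‖) * Mp ≤ 2 * (κ₀ * δ' / (4 * Mp)) * Mp :=
          mul_le_mul_of_nonneg_right h2 hMp.le
      _ = κ₀ * δ' / 2 := by field_simp; ring
  have hX : κ₀ * δ' / 2 ≤ (‖X₁‖ + ‖X₂‖) * Mp := by linarith
  rw [div_le_iff₀ (by positivity)]
  nlinarith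

/-- Identity-with-far-field + contact locality ⇒ locality (core of `AnomalyInsertionLocality_of`). [folklore] -/
theorem locality_assembly {σ ι₂ ι₃ : Type*} {E : Type*} [PseudoMetricSpace E] [Zero E]
    {Tens₂ : ι₂ → σ → σ → Prop} {Off₂ : ι₂ → Prop} {Cpt : σ → Prop} {Supp : σ → Set E}
    {Tens₃ : ι₃ → σ → σ → σ → Prop} {Off₃ : ι₃ → Prop} {Plateau : σ → ℝ → Prop}
    {W : ℕ → ι₂ → ℂ} {T : ℕ → ι₃ → ℂ} {D : ℕ → ι₂ → ℂ}
    (hball : ∀ f g : σ, Cpt f → Cpt g → ∃ R₀ : ℝ, Supp f ∪ Supp g ⊆ Metric.ball (0 : E) R₀)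
    (h₁ : ∀ (f g : σ) (F : ι₂), Tens₂ F f g → Off₂ F → Cpt f → Cpt g → ∀ ε : ℝ, 0 < ε →
      ∀ R₀ : ℝ, ∃ R : ℝ, R₀ ≤ R ∧ ∃ (χ : σ) (Hχ : ι₃), Tens₃ Hχ f g χ ∧ Plateau χ R ∧
        ∀ᶠ k in atTop, ‖D k F - T k Hχ‖ ≤ ε)
    (h₂ : ∃ d : ℝ → ℕ → ℂ, ∀ (f g : σ) (F : ι₂), Tens₂ F f g → Off₂ F → Cpt f → Cpt g →
      ∀ (R : ℝ) (χ : σ) (Hχ : ι₃), Tens₃ Hχ f g χ → Plateau χ R → Supp f ∪ Supp g ⊆ Metric.ball (0 : E) R →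
        ∀ ε : ℝ, 0 < ε → ∃ ρ₀ : ℝ, 0 < ρ₀ ∧ ∀ ρ : ℝ, 0 < ρ → ρ < ρ₀ →
          ∃ (N : ℕ) (H' : Fin N → ι₃), (∀ j, ∃ (f' g' h' : σ), Tens₃ (H' j) f' g' h' ∧ Off₃ (H' j)) ∧
            ∀ᶠ k in atTop, ‖T k Hχ - ∑ j, T k (H' j) - d ρ k * W k F‖ ≤ ε) :
    ∃ d : ℝ → ℕ → ℂ, ∀ (f g : σ) (F : ι₂), Tens₂ F f g → Off₂ F → Cpt f → Cpt g →
      ∀ ε : ℝ, 0 < ε → ∃ ρ₀ : ℝ, 0 < ρ₀ ∧ ∀ ρ : ℝ, 0 < ρ → ρ < ρ₀ →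
        ∃ (N : ℕ) (H' : Fin N → ι₃), (∀ j, ∃ (f' g' h' : σ), Tens₃ (H' j) f' g' h' ∧ Off₃ (H' j)) ∧
          ∀ᶠ k in atTop, ‖D k F - ∑ j, T k (H' j) - d ρ k * W k F‖ ≤ ε := by
  obtain ⟨d, hd⟩ := h₂
  refine ⟨d, fun f g F hT hO hf hg ε hε => ?_⟩
  obtain ⟨R₀, hR₀⟩ := hball f g hf hg
  have hε2 : 0 < ε / 2 := by positivity
  obtain ⟨R, hR, χ, Hχ, hTχ, hPl, hfar⟩ := h₁ f g F hT hO hf hg (ε / 2) hε2 R₀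
  have hsub : Supp f ∪ Supp g ⊆ Metric.ball (0 : E) R := hR₀.trans (Metric.ball_subset_ball hR)
  obtain ⟨ρ₀, hρ₀, hρ⟩ := hd f g F hT hO hf hg R χ Hχ hTχ hPl hsub (ε / 2) hε2
  refine ⟨ρ₀, hρ₀, fun ρ hρp hρl => ?_⟩
  obtain ⟨N, H', hH', hev⟩ := hρ ρ hρp hρl
  refine ⟨N, H', hH', ?_⟩
  filter_upwards [hfar, hev] with k hk₁ hk₂
  have e : D k F - ∑ j, T k (H' j) - d ρ k * W k F =
      (D k F - T k Hχ) + (T k Hχ - ∑ j, T k (H' j) - d ρ k * W k F) := by ring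
  rw [e]
  exact (norm_add_le _ _).trans (by linarith)

/-! ## §1 The three pieces (VERBATIM the children statements of `children.json`; local copies until the split lands) -/

/-- **Piece A · `AnomalyInsertionLocality`** (route child; OPE / contact structure of the anomaly insertion; OPEN). -/
def AnomalyInsertionLocality : Prop :=
  open Literature.MathematicalPhysics.QuantumFieldTheory Literature.MathematicalPhysics.QuantumLattice Literature.MathematicalPhysics.AQFT Literature.Probability.LatticeModels in ∀ (G : Type) [Group G] [TopologicalSpace G] [IsTopologicalGroup G] [CompactSpace G], IsCompactSimpleLieGroup G → letI : MeasurableSpace G := borel G; haveI : BorelSpace G := ⟨rfl⟩; ∀ (r : LatticeRep G) (sch : SpeciesScheme (YMSpecies G)), let μ := fun k : ℕ => wilsonMeasure (d := 4) (L := sch.side k) r.ρ (sch.β k); let LS := fun (k n : ℕ) (F : SchwartzMap (Fin n → EuclideanSpace ℝ (Fin 4)) ℂ) => (∫ U, ∑ x : Fin n → ↥(box 4 (sch.L k)), F (fun i => sch.a k • siteToE ↑(x i)) * ∏ i, ((sch.c r.curvature k * sch.a k ^ 4 * (r.curvature.F (configShift (-↑(x i)) (torusLift (sch.side k) U)) -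 sch.m r.curvature k) : ℝ) : ℂ) ∂μ k); let LSb := fun (k n : ℕ) (F : SchwartzMap (Fin n → EuclideanSpace ℝ (Fin 4)) ℂ) (b : ℝ) => (∫ U, ∑ x : Fin n → ↥(box 4 (sch.L k)), F (fun i => sch.a k • siteToE ↑(x i)) * ∏ i, ((sch.c r.curvature k * sch.a k ^ 4 * (r.curvature.F (configShift (-↑(x i)) (torusLift (sch.side k) U)) - sch.m r.curvature k) : ℝ) : ℂ) ∂(wilsonMeasure (d := 4) (L := sch.side k) r.ρ b)); let D := fun (k : ℕ) (F : SchwartzMap (Fin 2 → EuclideanSpace ℝ (Fin 4)) ℂ) => ((sch.c r.curvature k * sch.a k ^ 4 : ℝ) : ℂ) * deriv (fun b : ℝ => LSb k 2 F b) (sch.β k); (∀ k : ℕ, sch.m r.curvature k = ∫ U, r.curvature.F (torusLift (sch.side k) U) ∂μ k) → (∃ (s : ℕ) (α β : ℝ), ∀ (n : ℕ) (F : SchwartzMap (Fin n → EuclideanSpace ℝ (Fin 4)) ℂ), IsOffDiagonal F → ∀ᶠ k in Filter.atTop, ‖LS k n F‖ ≤ α * (n.factorial : ℝ) ^ β * schwartzNorm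 (n * s) F) → (∃ (f g : SchwartzMap (Fin 1 → EuclideanSpace ℝ (Fin 4)) ℂ) (H : SchwartzMap (Fin (1 + 1) → EuclideanSpace ℝ (Fin 4)) ℂ), IsTimeOrdered f ∧ IsTimeOrdered g ∧ IsAppendTensorOf H (osAdjoint f) g ∧ ∃ δ : ℝ, 0 < δ ∧ ∀ᶠ k in Filter.atTop, δ ≤ ‖LS k (1 + 1) H‖) → (∃ Δ : ℝ, 0 < Δ ∧ ∀ (n m : ℕ) (F : SchwartzMap (Fin n → EuclideanSpace ℝ (Fin 4)) ℂ) (G' : SchwartzMap (Fin m → EuclideanSpace ℝ (Fin 4)) ℂ), IsTimeOrdered F → IsTimeOrdered G' → ∃ C : ℝ, ∀ v : EuclideanSpace ℝ (Fin 4), 0 ≤ v 0 → ∀ᶠ k in Filter.atTop, ∀ H : SchwartzMap (Fin (n + m) → EuclideanSpace ℝ (Fin 4)) ℂ, IsAppendTensorOf H (osAdjoint F) (translateMulti v G') → ‖LS k (n + m) H - LS k n (osAdjoint F) * LS k m G'‖ ≤ C * Real.exp (-Δ * ‖v‖)) → Filter.Tendsto sch.β Filter.atTop Filter.atTop → (∀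 (f g : SchwartzMap (EuclideanSpace ℝ (Fin 4)) ℂ) (F₂ : SchwartzMap (Fin 2 → EuclideanSpace ℝ (Fin 4)) ℂ), IsTensorOf F₂ ![f, g] → IsOffDiagonal F₂ → HasCompactSupport ⇑f → HasCompactSupport ⇑g → ∀ ε : ℝ, 0 < ε → ∃ R : ℝ, ∀ᶠ k in Filter.atTop, ∀ (h : SchwartzMap (EuclideanSpace ℝ (Fin 4)) ℂ) (H : SchwartzMap (Fin 3 → EuclideanSpace ℝ (Fin 4)) ℂ), IsTensorOf H ![f, g, h] → (∀ x, ‖x‖ ≤ R → h x = 0) → (∀ x, ‖h x‖ ≤ 1) → ‖LS k 3 H‖ ≤ ε) → ∃ d : ℝ → ℕ → ℂ, ∀ (f g : SchwartzMap (EuclideanSpace ℝ (Fin 4)) ℂ) (F₂ : SchwartzMap (Fin 2 → EuclideanSpace ℝ (Fin 4)) ℂ), IsTensorOf F₂ ![f, g] → IsOffDiagonal F₂ → HasCompactSupport ⇑f → HasCompactSupport ⇑g → ∀ ε : ℝ, 0 < ε → ∃ ρ₀ : ℝ, 0 < ρ₀ ∧ ∀ ρ : ℝ, 0 < ρ → ρ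 < ρ₀ → ∃ (N : ℕ) (H' : Fin N → SchwartzMap (Fin 3 → EuclideanSpace ℝ (Fin 4)) ℂ), (∀ j, ∃ (f' g' h' : SchwartzMap (EuclideanSpace ℝ (Fin 4)) ℂ), IsTensorOf (H' j) ![f', g', h'] ∧ IsOffDiagonal (H' j)) ∧ ∀ᶠ k in Filter.atTop, ‖D k F₂ - ∑ j, LS k 3 (H' j) - d ρ k * LS k 2 F₂‖ ≤ ε

/-- **Piece B · `CouplingDerivativeTransmutation`** (route child; dimensional transmutation at the two-point level; OPEN). -/
def CouplingDerivativeTransmutation : Prop :=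
  open Literature.MathematicalPhysics.QuantumFieldTheory Literature.MathematicalPhysics.QuantumLattice Literature.MathematicalPhysics.AQFT Literature.Probability.LatticeModels in ∀ (G : Type) [Group G] [TopologicalSpace G] [IsTopologicalGroup G] [CompactSpace G], IsCompactSimpleLieGroup G → letI : MeasurableSpace G := borel G; haveI : BorelSpace G := ⟨rfl⟩; ∀ (r : LatticeRep G) (sch : SpeciesScheme (YMSpecies G)), let μ := fun k : ℕ => wilsonMeasure (d := 4) (L := sch.side k) r.ρ (sch.β k); let LS := fun (k n : ℕ) (F : SchwartzMap (Fin n → EuclideanSpace ℝ (Fin 4)) ℂ) => (∫ U, ∑ x : Fin n → ↥(box 4 (sch.L k)), F (fun i => sch.a k • siteToE ↑(x i)) * ∏ i, ((sch.c r.curvature k * sch.a k ^ 4 * (r.curvature.F (configShift (-↑(x i)) (torusLift (sch.side k) U)) - sch.m r.curvature k) : ℝ) : ℂ) ∂μ k); let LSb := fun (k n : ℕ) (F : SchwartzMap (Fin n → EuclideanSpace ℝ (Fin 4)) ℂ) (b : ℝ) => (∫ U, ∑ x : Fin n → ↥(box 4 (sch.L k)), F (fun i => sch.a k • siteToE ↑(x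 i)) * ∏ i, ((sch.c r.curvature k * sch.a k ^ 4 * (r.curvature.F (configShift (-↑(x i)) (torusLift (sch.side k) U)) - sch.m r.curvature k) : ℝ) : ℂ) ∂(wilsonMeasure (d := 4) (L := sch.side k) r.ρ b)); let D := fun (k : ℕ) (F : SchwartzMap (Fin 2 → EuclideanSpace ℝ (Fin 4)) ℂ) => ((sch.c r.curvature k * sch.a k ^ 4 : ℝ) : ℂ) * deriv (fun b : ℝ => LSb k 2 F b) (sch.β k); (∀ k : ℕ, sch.m r.curvature k = ∫ U, r.curvature.F (torusLift (sch.side k) U) ∂μ k) → (∃ (s : ℕ) (α β : ℝ), ∀ (n : ℕ) (F : SchwartzMap (Fin n → EuclideanSpace ℝ (Fin 4)) ℂ), IsOffDiagonal F → ∀ᶠ k in Filter.atTop, ‖LS k n F‖ ≤ α * (n.factorial : ℝ) ^ β * schwartzNorm (n * s) F) → (∃ (f g : SchwartzMap (Fin 1 → EuclideanSpace ℝ (Fin 4)) ℂ) (H : SchwartzMap (Fin (1 + 1) → EuclideanSpace ℝ (Fin 4)) ℂ), IsTimeOrdered f ∧ IsTimeOrdered g ∧ IsAppendTensorOf H (osAdjoint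 f) g ∧ ∃ δ : ℝ, 0 < δ ∧ ∀ᶠ k in Filter.atTop, δ ≤ ‖LS k (1 + 1) H‖) → (∃ Δ : ℝ, 0 < Δ ∧ ∀ (n m : ℕ) (F : SchwartzMap (Fin n → EuclideanSpace ℝ (Fin 4)) ℂ) (G' : SchwartzMap (Fin m → EuclideanSpace ℝ (Fin 4)) ℂ), IsTimeOrdered F → IsTimeOrdered G' → ∃ C : ℝ, ∀ v : EuclideanSpace ℝ (Fin 4), 0 ≤ v 0 → ∀ᶠ k in Filter.atTop, ∀ H : SchwartzMap (Fin (n + m) → EuclideanSpace ℝ (Fin 4)) ℂ, IsAppendTensorOf H (osAdjoint F) (translateMulti v G') → ‖LS k (n + m) H - LS k n (osAdjoint F) * LS k m G'‖ ≤ C * Real.exp (-Δ * ‖v‖)) → Filter.Tendsto sch.β Filter.atTop Filter.atTop → ∃ (f₁ g₁ f₂ g₂ : SchwartzMap (EuclideanSpace ℝ (Fin 4)) ℂ) (F₁ F₂ : SchwartzMap (Fin 2 → EuclideanSpace ℝ (Fin 4)) ℂ), IsTensorOf F₁ ![f₁, g₁] ∧ IsTensorOf F₂ ![f₂, g₂]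 ∧ IsOffDiagonal F₁ ∧ IsOffDiagonal F₂ ∧ HasCompactSupport ⇑f₁ ∧ HasCompactSupport ⇑g₁ ∧ HasCompactSupport ⇑f₂ ∧ HasCompactSupport ⇑g₂ ∧ ∃ δ : ℝ, 0 < δ ∧ ∀ d : ℕ → ℂ, ∃ᶠ k in Filter.atTop, δ ≤ ‖D k F₁ - d k * LS k 2 F₁‖ + ‖D k F₂ - d k * LS k 2 F₂‖

/-- **Piece C · `NonGaussianityOffScaling`** (route child; the crux outside the (AF ∧ UC) regime; OPEN, scope piece). -/
def NonGaussianityOffScaling : Prop :=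
  open Literature.MathematicalPhysics.QuantumFieldTheory Literature.MathematicalPhysics.QuantumLattice Literature.MathematicalPhysics.AQFT Literature.Probability.LatticeModels in ∀ (G : Type) [Group G] [TopologicalSpace G] [IsTopologicalGroup G] [CompactSpace G], IsCompactSimpleLieGroup G → letI : MeasurableSpace G := borel G; haveI : BorelSpace G := ⟨rfl⟩; ∀ (r : LatticeRep G) (sch : SpeciesScheme (YMSpecies G)), let μ := fun k : ℕ => wilsonMeasure (d := 4) (L := sch.side k) r.ρ (sch.β k); let LS := fun (k n : ℕ) (F : SchwartzMap (Fin n → EuclideanSpace ℝ (Fin 4)) ℂ) => (∫ U, ∑ x : Fin n → ↥(box 4 (sch.L k)), F (fun i => sch.a k • siteToE ↑(x i)) * ∏ i, ((sch.c r.curvature k * sch.a k ^ 4 * (r.curvature.F (configShift (-↑(x i)) (torusLift (sch.side k) U)) - sch.m r.curvature k) : ℝ) : ℂ) ∂μ k); (∀ k : ℕ, sch.m r.curvature k = ∫ U, r.curvature.F (torusLift (sch.side k) U) ∂μ k) → (∃ (s : ℕ) (α β : ℝ), ∀ (n : ℕ) (F : SchwartzMap (Fin n → EuclideanSpace ℝ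 (Fin 4)) ℂ), IsOffDiagonal F → ∀ᶠ k in Filter.atTop, ‖LS k n F‖ ≤ α * (n.factorial : ℝ) ^ β * schwartzNorm (n * s) F) → (∃ (f g : SchwartzMap (Fin 1 → EuclideanSpace ℝ (Fin 4)) ℂ) (H : SchwartzMap (Fin (1 + 1) → EuclideanSpace ℝ (Fin 4)) ℂ), IsTimeOrdered f ∧ IsTimeOrdered g ∧ IsAppendTensorOf H (osAdjoint f) g ∧ ∃ δ : ℝ, 0 < δ ∧ ∀ᶠ k in Filter.atTop, δ ≤ ‖LS k (1 + 1) H‖) → (∃ Δ : ℝ, 0 < Δ ∧ ∀ (n m : ℕ) (F : SchwartzMap (Fin n → EuclideanSpace ℝ (Fin 4)) ℂ) (G' : SchwartzMap (Fin m → EuclideanSpace ℝ (Fin 4)) ℂ), IsTimeOrdered F → IsTimeOrdered G' → ∃ C : ℝ, ∀ v : EuclideanSpace ℝ (Fin 4), 0 ≤ v 0 → ∀ᶠ k in Filter.atTop, ∀ H : SchwartzMap (Fin (n + m) → EuclideanSpace ℝ (Fin 4)) ℂ, IsAppendTensorOf H (osAdjoint F) (translateMulti v G') → ‖LS k (n +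 m) H - LS k n (osAdjoint F) * LS k m G'‖ ≤ C * Real.exp (-Δ * ‖v‖)) → ¬ (Filter.Tendsto sch.β Filter.atTop Filter.atTop ∧ (∀ (f g : SchwartzMap (EuclideanSpace ℝ (Fin 4)) ℂ) (F₂ : SchwartzMap (Fin 2 → EuclideanSpace ℝ (Fin 4)) ℂ), IsTensorOf F₂ ![f, g] → IsOffDiagonal F₂ → HasCompactSupport ⇑f → HasCompactSupport ⇑g → ∀ ε : ℝ, 0 < ε → ∃ R : ℝ, ∀ᶠ k in Filter.atTop, ∀ (h : SchwartzMap (EuclideanSpace ℝ (Fin 4)) ℂ) (H : SchwartzMap (Fin 3 → EuclideanSpace ℝ (Fin 4)) ℂ), IsTensorOf H ![f, g, h] → (∀ x, ‖x‖ ≤ R → h x = 0) → (∀ x, ‖h x‖ ≤ 1) → ‖LS k 3 H‖ ≤ ε)) → ∃ (f g h : SchwartzMap (EuclideanSpace ℝ (Fin 4)) ℂ) (F₃ : SchwartzMap (Fin 3 → EuclideanSpace ℝ (Fin 4)) ℂ), IsTensorOf F₃ ![f, g, h] ∧ IsOffDiagonal F₃ ∧ ∃ δ : ℝ, 0 < δ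 ∧ ∃ᶠ k in Filter.atTop, δ ≤ ‖LS k 3 F₃‖

/-! ## §2 The six obligations (named; the registered stubs of §3 have exactly these types) -/

/-- **A1 · `InsertionIdentityFar` — exact action-insertion identity + far field** (PROVABLE, L): `D_k(F) = c_k a_k⁴ ∂_b LS_b(k,2,F)|_(β_k)` equals the FULL torus sum of the third curvature insertion (differentiate the Gibbs expectation; the one-point function vanishes by (VS) and torus translation invariance), and by the uniform-clustering hypothesis (UC; the far cut-off `h = 1 − χ` is realised at each `k` by a Schwartz function on the finite box — UC quantifies `h` after `k`) it is within `ε` of the plateau-smeared functional `LS(k,3,f⊗g⊗χ)` for some plateau `χ ≡ 1` on any prescribed ball. [Luscher2010WilsonFlow] -/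
def InsertionIdentityFar : Prop :=
  open Literature.MathematicalPhysics.QuantumFieldTheory Literature.MathematicalPhysics.QuantumLattice Literature.MathematicalPhysics.AQFT Literature.Probability.LatticeModels in ∀ (G : Type) [Group G] [TopologicalSpace G] [IsTopologicalGroup G] [CompactSpace G] [MeasurableSpace G] [BorelSpace G], IsCompactSimpleLieGroup G → ∀ (r : LatticeRep G) (sch : SpeciesScheme (YMSpecies G)) (LS : (k n : ℕ) → SchwartzMap (Fin n → EuclideanSpace ℝ (Fin 4)) ℂ → ℂ), (LS = fun (k n : ℕ) (F : SchwartzMap (Fin n → EuclideanSpace ℝ (Fin 4)) ℂ) => (∫ U, ∑ x : Fin n → ↥(box 4 (sch.L k)), F (fun i => sch.a k • siteToE ↑(x i)) * ∏ i, ((sch.c r.curvature k * sch.a k ^ 4 * (r.curvature.F (configShift (-↑(x i)) (torusLift (sch.side k) U)) - sch.m r.curvature k) : ℝ) : ℂ) ∂(wilsonMeasure r.ρ (sch.β k) : MeasureTheory.Measure (GaugeConfig 4 (sch.side k) G)))) → ∀ (LSb : (k n : ℕ) → SchwartzMap (Fin n → EuclideanSpace ℝ (Fin 4)) ℂ → ℝ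 → ℂ), (LSb = fun (k n : ℕ) (F : SchwartzMap (Fin n → EuclideanSpace ℝ (Fin 4)) ℂ) (b : ℝ) => (∫ U, ∑ x : Fin n → ↥(box 4 (sch.L k)), F (fun i => sch.a k • siteToE ↑(x i)) * ∏ i, ((sch.c r.curvature k * sch.a k ^ 4 * (r.curvature.F (configShift (-↑(x i)) (torusLift (sch.side k) U)) - sch.m r.curvature k) : ℝ) : ℂ) ∂(wilsonMeasure r.ρ b : MeasureTheory.Measure (GaugeConfig 4 (sch.side k) G)))) → ∀ (D : ℕ → SchwartzMap (Fin 2 → EuclideanSpace ℝ (Fin 4)) ℂ → ℂ), (D = fun (k : ℕ) (F : SchwartzMap (Fin 2 → EuclideanSpace ℝ (Fin 4)) ℂ) => ((sch.c r.curvature k * sch.a k ^ 4 : ℝ) : ℂ) * deriv (fun b : ℝ => LSb k 2 F b) (sch.β k)) → (∀ k : ℕ, sch.m r.curvature k = ∫ U, r.curvature.F (torusLift (sch.side k) U) ∂(wilsonMeasure r.ρ (sch.β k) : MeasureTheory.Measure (GaugeConfig 4 (sch.side k) G))) → (∃ (s : ℕ) (α β : ℝ), ∀ (n : ℕ) (F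 : SchwartzMap (Fin n → EuclideanSpace ℝ (Fin 4)) ℂ), IsOffDiagonal F → ∀ᶠ k in Filter.atTop, ‖LS k n F‖ ≤ α * (n.factorial : ℝ) ^ β * schwartzNorm (n * s) F) → (∃ (f g : SchwartzMap (Fin 1 → EuclideanSpace ℝ (Fin 4)) ℂ) (H : SchwartzMap (Fin (1 + 1) → EuclideanSpace ℝ (Fin 4)) ℂ), IsTimeOrdered f ∧ IsTimeOrdered g ∧ IsAppendTensorOf H (osAdjoint f) g ∧ ∃ δ : ℝ, 0 < δ ∧ ∀ᶠ k in Filter.atTop, δ ≤ ‖LS k (1 + 1) H‖) → (∃ Δ : ℝ, 0 < Δ ∧ ∀ (n m : ℕ) (F : SchwartzMap (Fin n → EuclideanSpace ℝ (Fin 4)) ℂ) (G' : SchwartzMap (Fin m → EuclideanSpace ℝ (Fin 4)) ℂ), IsTimeOrdered F → IsTimeOrdered G' → ∃ C : ℝ, ∀ v : EuclideanSpace ℝ (Fin 4), 0 ≤ v 0 → ∀ᶠ k in Filter.atTop, ∀ H : SchwartzMap (Fin (n + m) → EuclideanSpace ℝ (Fin 4)) ℂ, IsAppendTensorOf H (osAdjoint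 F) (translateMulti v G') → ‖LS k (n + m) H - LS k n (osAdjoint F) * LS k m G'‖ ≤ C * Real.exp (-Δ * ‖v‖)) → Filter.Tendsto sch.β Filter.atTop Filter.atTop → (∀ (f g : SchwartzMap (EuclideanSpace ℝ (Fin 4)) ℂ) (F₂ : SchwartzMap (Fin 2 → EuclideanSpace ℝ (Fin 4)) ℂ), IsTensorOf F₂ ![f, g] → IsOffDiagonal F₂ → HasCompactSupport ⇑f → HasCompactSupport ⇑g → ∀ ε : ℝ, 0 < ε → ∃ R : ℝ, ∀ᶠ k in Filter.atTop, ∀ (h : SchwartzMap (EuclideanSpace ℝ (Fin 4)) ℂ) (H : SchwartzMap (Fin 3 → EuclideanSpace ℝ (Fin 4)) ℂ), IsTensorOf H ![f, g, h] → (∀ x, ‖x‖ ≤ R → h x = 0) → (∀ x, ‖h x‖ ≤ 1) → ‖LS k 3 H‖ ≤ ε) → ∀ (f g : SchwartzMap (EuclideanSpace ℝ (Fin 4)) ℂ) (F₂ : SchwartzMap (Fin 2 → EuclideanSpace ℝ (Fin 4)) ℂ), IsTensorOf F₂ ![f, g] → IsOffDiagonal F₂ → HasCompactSupport ⇑f →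 HasCompactSupport ⇑g → ∀ ε : ℝ, 0 < ε → ∀ R₀ : ℝ, ∃ R : ℝ, R₀ ≤ R ∧ ∃ (χ : SchwartzMap (EuclideanSpace ℝ (Fin 4)) ℂ) (Hχ : SchwartzMap (Fin 3 → EuclideanSpace ℝ (Fin 4)) ℂ), IsTensorOf Hχ ![f, g, χ] ∧ (∀ x : EuclideanSpace ℝ (Fin 4), ‖x‖ ≤ R → χ x = 1) ∧ ∀ᶠ k in Filter.atTop, ‖D k F₂ - LS k 3 Hχ‖ ≤ ε

/-- **A2 · `ContactLocality` — contact locality of the plateau insertion** (OPEN — the OPE core, the load-bearing stub): there is a UNIVERSAL family `d(ρ)_k` (integrated `φ×φ → φ` coefficient at cut-off `ρ`, lattice contact terms included) such that for every compactly supported off-diagonal `f⊗g` and every plateau `χ` covering the supports, `LS(k,3,f⊗g⊗χ) = d(ρ)_k LS(k,2,f⊗g) + Σⱼ LS(k,3,H'ⱼ) ± ε` eventually, `H'ⱼ` finitely many OFF-DIAGONAL pure tensors (pieces of `f, g` of diameter `≪ ρ` times radial shells; the Schwartz tail of `χ` by (UVB)); higher operators are `O(ρ²)`, odd ones cancel on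 balls. [LuscherWeisz2011; arXiv:1304.0533] -/
def ContactLocality : Prop :=
  open Literature.MathematicalPhysics.QuantumFieldTheory Literature.MathematicalPhysics.QuantumLattice Literature.MathematicalPhysics.AQFT Literature.Probability.LatticeModels in ∀ (G : Type) [Group G] [TopologicalSpace G] [IsTopologicalGroup G] [CompactSpace G] [MeasurableSpace G] [BorelSpace G], IsCompactSimpleLieGroup G → ∀ (r : LatticeRep G) (sch : SpeciesScheme (YMSpecies G)) (LS : (k n : ℕ) → SchwartzMap (Fin n → EuclideanSpace ℝ (Fin 4)) ℂ → ℂ), (LS = fun (k n : ℕ) (F : SchwartzMap (Fin n → EuclideanSpace ℝ (Fin 4)) ℂ) => (∫ U, ∑ x : Fin n → ↥(box 4 (sch.L k)), F (fun i => sch.a k • siteToE ↑(x i)) * ∏ i, ((sch.c r.curvature k * sch.a k ^ 4 * (r.curvature.F (configShift (-↑(x i)) (torusLift (sch.side k) U)) - sch.m r.curvature k) : ℝ) : ℂ) ∂(wilsonMeasure r.ρ (sch.β k) : MeasureTheory.Measure (GaugeConfig 4 (sch.side k) G)))) → (∀ k : ℕ, sch.m r.curvature k = ∫ U, r.curvature.F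 (torusLift (sch.side k) U) ∂(wilsonMeasure r.ρ (sch.β k) : MeasureTheory.Measure (GaugeConfig 4 (sch.side k) G))) → (∃ (s : ℕ) (α β : ℝ), ∀ (n : ℕ) (F : SchwartzMap (Fin n → EuclideanSpace ℝ (Fin 4)) ℂ), IsOffDiagonal F → ∀ᶠ k in Filter.atTop, ‖LS k n F‖ ≤ α * (n.factorial : ℝ) ^ β * schwartzNorm (n * s) F) → (∃ (f g : SchwartzMap (Fin 1 → EuclideanSpace ℝ (Fin 4)) ℂ) (H : SchwartzMap (Fin (1 + 1) → EuclideanSpace ℝ (Fin 4)) ℂ), IsTimeOrdered f ∧ IsTimeOrdered g ∧ IsAppendTensorOf H (osAdjoint f) g ∧ ∃ δ : ℝ, 0 < δ ∧ ∀ᶠ k in Filter.atTop, δ ≤ ‖LS k (1 + 1) H‖) → (∃ Δ : ℝ, 0 < Δ ∧ ∀ (n m : ℕ) (F : SchwartzMap (Fin n → EuclideanSpace ℝ (Fin 4)) ℂ) (G' : SchwartzMap (Fin m → EuclideanSpace ℝ (Fin 4)) ℂ), IsTimeOrdered F → IsTimeOrdered G' → ∃ C : ℝ, ∀ v : EuclideanSpace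 ℝ (Fin 4), 0 ≤ v 0 → ∀ᶠ k in Filter.atTop, ∀ H : SchwartzMap (Fin (n + m) → EuclideanSpace ℝ (Fin 4)) ℂ, IsAppendTensorOf H (osAdjoint F) (translateMulti v G') → ‖LS k (n + m) H - LS k n (osAdjoint F) * LS k m G'‖ ≤ C * Real.exp (-Δ * ‖v‖)) → Filter.Tendsto sch.β Filter.atTop Filter.atTop → ∃ d : ℝ → ℕ → ℂ, ∀ (f g : SchwartzMap (EuclideanSpace ℝ (Fin 4)) ℂ) (F₂ : SchwartzMap (Fin 2 → EuclideanSpace ℝ (Fin 4)) ℂ), IsTensorOf F₂ ![f, g] → IsOffDiagonal F₂ → HasCompactSupport ⇑f → HasCompactSupport ⇑g → ∀ (R : ℝ) (χ : SchwartzMap (EuclideanSpace ℝ (Fin 4)) ℂ) (Hχ : SchwartzMap (Fin 3 → EuclideanSpace ℝ (Fin 4)) ℂ), IsTensorOf Hχ ![f, g, χ] → (∀ x : EuclideanSpace ℝ (Fin 4), ‖x‖ ≤ R → χ x = 1) → tsupport ⇑f ∪ tsupport ⇑g ⊆ Metric.ball (0 : EuclideanSpace ℝ (Fin 4)) R → ∀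 ε : ℝ, 0 < ε → ∃ ρ₀ : ℝ, 0 < ρ₀ ∧ ∀ ρ : ℝ, 0 < ρ → ρ < ρ₀ → ∃ (N : ℕ) (H' : Fin N → SchwartzMap (Fin 3 → EuclideanSpace ℝ (Fin 4)) ℂ), (∀ j, ∃ (f' g' h' : SchwartzMap (EuclideanSpace ℝ (Fin 4)) ℂ), IsTensorOf (H' j) ![f', g', h'] ∧ IsOffDiagonal (H' j)) ∧ ∀ᶠ k in Filter.atTop, ‖LS k 3 Hχ - ∑ j, LS k 3 (H' j) - d ρ k * LS k 2 F₂‖ ≤ ε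

/-- **B1 · `CouplingDerivativeIsDilation` — the coupling derivative is a dilation** (OPEN — non-perturbative Callan–Symanzik along the scheme): `D_k(F) = κ_k LS(k,2,F_d) + κ'_k LS(k,2,F) + o(1)` with `‖κ_k‖ ≥ κ₀ > 0` eventually, where `F_d(x) = −8F(x) − DF(x)[x]` generates dilations of two-point test functions (`κ = −(lim c_k a_k⁴)·(d log a/dβ)`, finite and non-zero by asymptotic freedom; `κ'` carries the anomalous drift of `c`). [tHooft1976; LuscherWeisz2011] -/
def CouplingDerivativeIsDilation : Prop :=
  open Literature.MathematicalPhysics.QuantumFieldTheory Literature.MathematicalPhysics.QuantumLattice Literature.MathematicalPhysics.AQFT Literature.Probability.LatticeModels in ∀ (G : Type) [Group G] [TopologicalSpace G] [IsTopologicalGroup G] [CompactSpace G] [MeasurableSpace G] [BorelSpace G], IsCompactSimpleLieGroup G → ∀ (r : LatticeRep G) (sch : SpeciesScheme (YMSpecies G)) (LS : (k n : ℕ) → SchwartzMap (Fin n → EuclideanSpace ℝ (Fin 4)) ℂ → ℂ), (LS = fun (k n : ℕ) (F : SchwartzMap (Fin n → EuclideanSpace ℝ (Fin 4)) ℂ)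 => (∫ U, ∑ x : Fin n → ↥(box 4 (sch.L k)), F (fun i => sch.a k • siteToE ↑(x i)) * ∏ i, ((sch.c r.curvature k * sch.a k ^ 4 * (r.curvature.F (configShift (-↑(x i)) (torusLift (sch.side k) U)) - sch.m r.curvature k) : ℝ) : ℂ) ∂(wilsonMeasure r.ρ (sch.β k) : MeasureTheory.Measure (GaugeConfig 4 (sch.side k) G)))) → ∀ (LSb : (k n : ℕ) → SchwartzMap (Fin n → EuclideanSpace ℝ (Fin 4)) ℂ → ℝ → ℂ), (LSb = fun (k n : ℕ) (F : SchwartzMap (Fin n → EuclideanSpace ℝ (Fin 4)) ℂ) (b : ℝ) => (∫ U, ∑ x : Fin n → ↥(box 4 (sch.L k)), F (fun i => sch.a k • siteToE ↑(x i)) * ∏ i, ((sch.c r.curvature k * sch.a k ^ 4 * (r.curvature.F (configShift (-↑(x i)) (torusLift (sch.side k) U)) - sch.m r.curvature k) : ℝ) : ℂ) ∂(wilsonMeasure r.ρ b : MeasureTheory.Measure (GaugeConfig 4 (sch.side k) G)))) → ∀ (D : ℕ → SchwartzMap (Fin 2 → EuclideanSpace ℝ (Fin 4)) ℂ → ℂ),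 (D = fun (k : ℕ) (F : SchwartzMap (Fin 2 → EuclideanSpace ℝ (Fin 4)) ℂ) => ((sch.c r.curvature k * sch.a k ^ 4 : ℝ) : ℂ) * deriv (fun b : ℝ => LSb k 2 F b) (sch.β k)) → (∀ k : ℕ, sch.m r.curvature k = ∫ U, r.curvature.F (torusLift (sch.side k) U) ∂(wilsonMeasure r.ρ (sch.β k) : MeasureTheory.Measure (GaugeConfig 4 (sch.side k) G))) → (∃ (s : ℕ) (α β : ℝ), ∀ (n : ℕ) (F : SchwartzMap (Fin n → EuclideanSpace ℝ (Fin 4)) ℂ), IsOffDiagonal F → ∀ᶠ k in Filter.atTop, ‖LS k n F‖ ≤ α * (n.factorial : ℝ) ^ β * schwartzNorm (n * s) F) → (∃ (f g : SchwartzMap (Fin 1 → EuclideanSpace ℝ (Fin 4)) ℂ) (H : SchwartzMap (Fin (1 + 1) → EuclideanSpace ℝ (Fin 4)) ℂ), IsTimeOrdered f ∧ IsTimeOrdered g ∧ IsAppendTensorOf H (osAdjoint f) g ∧ ∃ δ : ℝ, 0 < δ ∧ ∀ᶠ k in Filter.atTop, δ ≤ ‖LS k (1 + 1) H‖) → (∃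 Δ : ℝ, 0 < Δ ∧ ∀ (n m : ℕ) (F : SchwartzMap (Fin n → EuclideanSpace ℝ (Fin 4)) ℂ) (G' : SchwartzMap (Fin m → EuclideanSpace ℝ (Fin 4)) ℂ), IsTimeOrdered F → IsTimeOrdered G' → ∃ C : ℝ, ∀ v : EuclideanSpace ℝ (Fin 4), 0 ≤ v 0 → ∀ᶠ k in Filter.atTop, ∀ H : SchwartzMap (Fin (n + m) → EuclideanSpace ℝ (Fin 4)) ℂ, IsAppendTensorOf H (osAdjoint F) (translateMulti v G') → ‖LS k (n + m) H - LS k n (osAdjoint F) * LS k m G'‖ ≤ C * Real.exp (-Δ * ‖v‖)) → Filter.Tendsto sch.β Filter.atTop Filter.atTop → ∃ κ κ' : ℕ → ℂ, (∃ κ₀ : ℝ, 0 < κ₀ ∧ ∀ᶠ k in Filter.atTop, κ₀ ≤ ‖κ k‖) ∧ ∀ (f g : SchwartzMap (EuclideanSpace ℝ (Fin 4)) ℂ) (F₂ Fd : SchwartzMap (Fin 2 → EuclideanSpace ℝ (Fin 4)) ℂ), IsTensorOf F₂ ![f, g] → IsOffDiagonal F₂ → HasCompactSupport ⇑f → HasCompactSupport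 ⇑g → (∀ x, Fd x = -8 * F₂ x - fderiv ℝ (⇑F₂) x x) → Filter.Tendsto (fun k : ℕ => D k F₂ - κ k * LS k 2 Fd - κ' k * LS k 2 F₂) Filter.atTop (nhds 0)

/-- **B2 · `TwoPointNotHomogeneous` — a clustering non-zero two-point functional is not homogeneous** (PROVABLE-grade analysis, L): by (UVB) (bounded equicontinuous family, `‖LS(k,2,Fᵢ)‖ ≤ M`), (ND) (a non-zero limit point), lattice translation invariance with `a_k → 0`, and (CL) (exponential clustering of every limit point): two compactly supported off-diagonal pure tensors whose dilation determinant `LS(k,2,F_d1)LS(k,2,F₂) − LS(k,2,F_d2)LS(k,2,F₁)` is `≥ δ' > 0` FREQUENTLY (along the subsequence of one limit point; a translation-invariant kernel homogeneous off the diagonal that decays exponentially vanishes there). [OsterwalderSchrader1975] -/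
def TwoPointNotHomogeneous : Prop :=
  open Literature.MathematicalPhysics.QuantumFieldTheory Literature.MathematicalPhysics.QuantumLattice Literature.MathematicalPhysics.AQFT Literature.Probability.LatticeModels in ∀ (G : Type) [Group G] [TopologicalSpace G] [IsTopologicalGroup G] [CompactSpace G] [MeasurableSpace G] [BorelSpace G], IsCompactSimpleLieGroup G → ∀ (r : LatticeRep G) (sch : SpeciesScheme (YMSpecies G)) (LS : (k n : ℕ) → SchwartzMap (Fin n → EuclideanSpace ℝ (Fin 4)) ℂ → ℂ), (LS = fun (k n : ℕ) (F : SchwartzMap (Fin n → EuclideanSpace ℝ (Fin 4)) ℂ) => (∫ U, ∑ x : Fin n → ↥(box 4 (sch.L k)), F (fun i => sch.a k • siteToE ↑(x i)) * ∏ i, ((sch.c r.curvature k * sch.a k ^ 4 * (r.curvature.F (configShift (-↑(x i)) (torusLift (sch.side k) U)) - sch.m r.curvature k) : ℝ) : ℂ) ∂(wilsonMeasure r.ρ (sch.β k) : MeasureTheory.Measure (GaugeConfig 4 (sch.side k) G)))) → (∀ k : ℕ, sch.m r.curvature k = ∫ U, r.curvature.F (torusLift (sch.side k) U) ∂(wilsonMeasure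 r.ρ (sch.β k) : MeasureTheory.Measure (GaugeConfig 4 (sch.side k) G))) → (∃ (s : ℕ) (α β : ℝ), ∀ (n : ℕ) (F : SchwartzMap (Fin n → EuclideanSpace ℝ (Fin 4)) ℂ), IsOffDiagonal F → ∀ᶠ k in Filter.atTop, ‖LS k n F‖ ≤ α * (n.factorial : ℝ) ^ β * schwartzNorm (n * s) F) → (∃ (f g : SchwartzMap (Fin 1 → EuclideanSpace ℝ (Fin 4)) ℂ) (H : SchwartzMap (Fin (1 + 1) → EuclideanSpace ℝ (Fin 4)) ℂ), IsTimeOrdered f ∧ IsTimeOrdered g ∧ IsAppendTensorOf H (osAdjoint f) g ∧ ∃ δ : ℝ, 0 < δ ∧ ∀ᶠ k in Filter.atTop, δ ≤ ‖LS k (1 + 1) H‖) → (∃ Δ : ℝ, 0 < Δ ∧ ∀ (n m : ℕ) (F : SchwartzMap (Fin n → EuclideanSpace ℝ (Fin 4)) ℂ) (G' : SchwartzMap (Fin m → EuclideanSpace ℝ (Fin 4)) ℂ), IsTimeOrdered F → IsTimeOrdered G' → ∃ C : ℝ, ∀ v : EuclideanSpace ℝ (Fin 4), 0 ≤ v 0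 → ∀ᶠ k in Filter.atTop, ∀ H : SchwartzMap (Fin (n + m) → EuclideanSpace ℝ (Fin 4)) ℂ, IsAppendTensorOf H (osAdjoint F) (translateMulti v G') → ‖LS k (n + m) H - LS k n (osAdjoint F) * LS k m G'‖ ≤ C * Real.exp (-Δ * ‖v‖)) → ∃ (f₁ g₁ f₂ g₂ : SchwartzMap (EuclideanSpace ℝ (Fin 4)) ℂ) (F₁ F₂ Fd₁ Fd₂ : SchwartzMap (Fin 2 → EuclideanSpace ℝ (Fin 4)) ℂ), IsTensorOf F₁ ![f₁, g₁] ∧ IsTensorOf F₂ ![f₂, g₂] ∧ IsOffDiagonal F₁ ∧ IsOffDiagonal F₂ ∧ HasCompactSupport ⇑f₁ ∧ HasCompactSupport ⇑g₁ ∧ HasCompactSupport ⇑f₂ ∧ HasCompactSupport ⇑g₂ ∧ (∀ x, Fd₁ x = -8 * F₁ x - fderiv ℝ (⇑F₁) x x) ∧ (∀ x, Fd₂ x = -8 * F₂ x - fderiv ℝ (⇑F₂) x x) ∧ ∃ δ' M : ℝ, 0 < δ' ∧ (∀ᶠ k in Filter.atTop, ‖LS k 2 F₁‖ ≤ M ∧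 ‖LS k 2 F₂‖ ≤ M) ∧ ∃ᶠ k in Filter.atTop, δ' ≤ ‖LS k 2 Fd₁ * LS k 2 F₂ - LS k 2 Fd₂ * LS k 2 F₁‖

/-- **C1 · `UniformClusteringAlongAF` — pointwise-to-uniform clustering along AF schemes** (OPEN — mass-gap type): along an asymptotically free scheme with (VS), (UVB), (ND), (CL) the three-point functional is uniformly `ℓ¹`-small in the far third variable (UC). Physically the uniform lattice gap (GAP) of `MassiveScalingSequence`, which `closes` has but does not pass to the crux; the recommended restatement of the crux turns this stub into a hypothesis. [OsterwalderSeiler1978; JaffeWitten2000] -/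
def UniformClusteringAlongAF : Prop :=
  open Literature.MathematicalPhysics.QuantumFieldTheory Literature.MathematicalPhysics.QuantumLattice Literature.MathematicalPhysics.AQFT Literature.Probability.LatticeModels in ∀ (G : Type) [Group G] [TopologicalSpace G] [IsTopologicalGroup G] [CompactSpace G] [MeasurableSpace G] [BorelSpace G], IsCompactSimpleLieGroup G → ∀ (r : LatticeRep G) (sch : SpeciesScheme (YMSpecies G)) (LS : (k n : ℕ) → SchwartzMap (Fin n → EuclideanSpace ℝ (Fin 4)) ℂ → ℂ), (LS = fun (k n : ℕ) (F : SchwartzMap (Fin n → EuclideanSpace ℝ (Fin 4)) ℂ) => (∫ U, ∑ x : Fin n → ↥(box 4 (sch.L k)), F (fun i => sch.a k • siteToE ↑(x i)) * ∏ i, ((sch.c r.curvature k * sch.a k ^ 4 * (r.curvature.F (configShift (-↑(x i)) (torusLift (sch.side k) U)) - sch.m r.curvature k) : ℝ) : ℂ) ∂(wilsonMeasure r.ρ (sch.β k) : MeasureTheory.Measure (GaugeConfig 4 (sch.side k) G)))) → (∀ k : ℕ, sch.m r.curvature k = ∫ U, r.curvature.F (torusLift (sch.side k) U) ∂(wilsonMeasure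 r.ρ (sch.β k) : MeasureTheory.Measure (GaugeConfig 4 (sch.side k) G))) → (∃ (s : ℕ) (α β : ℝ), ∀ (n : ℕ) (F : SchwartzMap (Fin n → EuclideanSpace ℝ (Fin 4)) ℂ), IsOffDiagonal F → ∀ᶠ k in Filter.atTop, ‖LS k n F‖ ≤ α * (n.factorial : ℝ) ^ β * schwartzNorm (n * s) F) → (∃ (f g : SchwartzMap (Fin 1 → EuclideanSpace ℝ (Fin 4)) ℂ) (H : SchwartzMap (Fin (1 + 1) → EuclideanSpace ℝ (Fin 4)) ℂ), IsTimeOrdered f ∧ IsTimeOrdered g ∧ IsAppendTensorOf H (osAdjoint f) g ∧ ∃ δ : ℝ, 0 < δ ∧ ∀ᶠ k in Filter.atTop, δ ≤ ‖LS k (1 + 1) H‖) → (∃ Δ : ℝ, 0 < Δ ∧ ∀ (n m : ℕ) (F : SchwartzMap (Fin n → EuclideanSpace ℝ (Fin 4)) ℂ) (G' : SchwartzMap (Fin m → EuclideanSpace ℝ (Fin 4)) ℂ), IsTimeOrdered F → IsTimeOrdered G' → ∃ C : ℝ, ∀ v : EuclideanSpace ℝ (Fin 4), 0 ≤ v 0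 → ∀ᶠ k in Filter.atTop, ∀ H : SchwartzMap (Fin (n + m) → EuclideanSpace ℝ (Fin 4)) ℂ, IsAppendTensorOf H (osAdjoint F) (translateMulti v G') → ‖LS k (n + m) H - LS k n (osAdjoint F) * LS k m G'‖ ≤ C * Real.exp (-Δ * ‖v‖)) → Filter.Tendsto sch.β Filter.atTop Filter.atTop → (∀ (f g : SchwartzMap (EuclideanSpace ℝ (Fin 4)) ℂ) (F₂ : SchwartzMap (Fin 2 → EuclideanSpace ℝ (Fin 4)) ℂ), IsTensorOf F₂ ![f, g] → IsOffDiagonal F₂ → HasCompactSupport ⇑f → HasCompactSupport ⇑g → ∀ ε : ℝ, 0 < ε → ∃ R : ℝ, ∀ᶠ k in Filter.atTop, ∀ (h : SchwartzMap (EuclideanSpace ℝ (Fin 4)) ℂ) (H : SchwartzMap (Fin 3 → EuclideanSpace ℝ (Fin 4)) ℂ), IsTensorOf H ![f, g, h] → (∀ x, ‖x‖ ≤ R → h x = 0) → (∀ x, ‖h x‖ ≤ 1) → ‖LS k 3 H‖ ≤ ε)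

/-- **C2 · `NonGaussianityOffAF` — non-Gaussianity off asymptotic freedom** (OPEN — lattice phase structure; scope artefact of the universal quantifier): the crux for schemes with `¬ β_k → +∞`: either (VS)+(UVB)+(ND)+(CL) are contradictory there (finite lattice correlation length kills ND ∧ UVB) or a finite-β critical point is met, where the energy operator's three-point function must be non-zero (doubtful at a Gaussian Bhanot–Creutz endpoint — the informative kill). [BhanotCreutz1981; OsterwalderSeiler1978] -/
def NonGaussianityOffAF : Prop :=
  open Literature.MathematicalPhysics.QuantumFieldTheory Literature.MathematicalPhysics.QuantumLattice Literature.MathematicalPhysics.AQFT Literature.Probability.LatticeModels in ∀ (G : Type) [Group G] [TopologicalSpace G] [IsTopologicalGroup G] [CompactSpace G] [MeasurableSpace G] [BorelSpace G], IsCompactSimpleLieGroup G → ∀ (r : LatticeRep G) (sch : SpeciesScheme (YMSpecies G)) (LS : (k n : ℕ) → SchwartzMap (Fin n → EuclideanSpace ℝ (Fin 4)) ℂ → ℂ), (LS = fun (k n : ℕ) (F : SchwartzMap (Fin n → EuclideanSpace ℝ (Fin 4)) ℂ) => (∫ U, ∑ x : Fin n → ↥(box 4 (sch.L k)), F (fun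 i => sch.a k • siteToE ↑(x i)) * ∏ i, ((sch.c r.curvature k * sch.a k ^ 4 * (r.curvature.F (configShift (-↑(x i)) (torusLift (sch.side k) U)) - sch.m r.curvature k) : ℝ) : ℂ) ∂(wilsonMeasure r.ρ (sch.β k) : MeasureTheory.Measure (GaugeConfig 4 (sch.side k) G)))) → (∀ k : ℕ, sch.m r.curvature k = ∫ U, r.curvature.F (torusLift (sch.side k) U) ∂(wilsonMeasure r.ρ (sch.β k) : MeasureTheory.Measure (GaugeConfig 4 (sch.side k) G))) → (∃ (s : ℕ) (α β : ℝ), ∀ (n : ℕ) (F : SchwartzMap (Fin n → EuclideanSpace ℝ (Fin 4)) ℂ), IsOffDiagonal F → ∀ᶠ k in Filter.atTop, ‖LS k n F‖ ≤ α * (n.factorial : ℝ) ^ β * schwartzNorm (n * s) F) → (∃ (f g : SchwartzMap (Fin 1 → EuclideanSpace ℝ (Fin 4)) ℂ) (H : SchwartzMap (Fin (1 + 1) → EuclideanSpace ℝ (Fin 4)) ℂ), IsTimeOrdered f ∧ IsTimeOrdered g ∧ IsAppendTensorOf H (osAdjoint f) g ∧ ∃ δ : ℝ, 0 < δ ∧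 ∀ᶠ k in Filter.atTop, δ ≤ ‖LS k (1 + 1) H‖) → (∃ Δ : ℝ, 0 < Δ ∧ ∀ (n m : ℕ) (F : SchwartzMap (Fin n → EuclideanSpace ℝ (Fin 4)) ℂ) (G' : SchwartzMap (Fin m → EuclideanSpace ℝ (Fin 4)) ℂ), IsTimeOrdered F → IsTimeOrdered G' → ∃ C : ℝ, ∀ v : EuclideanSpace ℝ (Fin 4), 0 ≤ v 0 → ∀ᶠ k in Filter.atTop, ∀ H : SchwartzMap (Fin (n + m) → EuclideanSpace ℝ (Fin 4)) ℂ, IsAppendTensorOf H (osAdjoint F) (translateMulti v G') → ‖LS k (n + m) H - LS k n (osAdjoint F) * LS k m G'‖ ≤ C * Real.exp (-Δ * ‖v‖)) → ¬ Filter.Tendsto sch.β Filter.atTop Filter.atTop → ∃ (f g h : SchwartzMap (EuclideanSpace ℝ (Fin 4)) ℂ) (F₃ : SchwartzMap (Fin 3 → EuclideanSpace ℝ (Fin 4)) ℂ), IsTensorOf F₃ ![f, g, h] ∧ IsOffDiagonal F₃ ∧ ∃ δ : ℝ, 0 < δ ∧ ∃ᶠ k in Filter.atTop, δ ≤ ‖LS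 k 3 F₃‖

/-! ## §3 Registered stubs (`sorry` lives only here; one per obligation, same short name) -/

namespace Stub

/-- Registered stub = obligation `InsertionIdentityFar` (PROVABLE-grade). -/
theorem InsertionIdentityFar : open Literature.MathematicalPhysics.QuantumFieldTheory Literature.MathematicalPhysics.QuantumLattice Literature.MathematicalPhysics.AQFT Literature.Probability.LatticeModels in ∀ (G : Type) [Group G] [TopologicalSpace G] [IsTopologicalGroup G] [CompactSpace G] [MeasurableSpace G] [BorelSpace G], IsCompactSimpleLieGroup G → ∀ (r : LatticeRep G) (sch : SpeciesScheme (YMSpecies G)) (LS : (k n : ℕ) → SchwartzMap (Fin n → EuclideanSpace ℝ (Fin 4)) ℂ → ℂ), (LS = fun (k n : ℕ) (F : SchwartzMap (Fin n → EuclideanSpace ℝ (Fin 4)) ℂ) => (∫ U, ∑ x : Fin n → ↥(box 4 (sch.L k)), F (fun i => sch.a k • siteToE ↑(x i)) * ∏ i, ((sch.c r.curvature k * sch.a k ^ 4 * (r.curvature.F (configShift (-↑(x i)) (torusLift (sch.side k) U)) - sch.m r.curvature k) : ℝ) : ℂ) ∂(wilsonMeasure r.ρ (sch.β k) : MeasureTheory.Measure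 (GaugeConfig 4 (sch.side k) G)))) → ∀ (LSb : (k n : ℕ) → SchwartzMap (Fin n → EuclideanSpace ℝ (Fin 4)) ℂ → ℝ → ℂ), (LSb = fun (k n : ℕ) (F : SchwartzMap (Fin n → EuclideanSpace ℝ (Fin 4)) ℂ) (b : ℝ) => (∫ U, ∑ x : Fin n → ↥(box 4 (sch.L k)), F (fun i => sch.a k • siteToE ↑(x i)) * ∏ i, ((sch.c r.curvature k * sch.a k ^ 4 * (r.curvature.F (configShift (-↑(x i)) (torusLift (sch.side k) U)) - sch.m r.curvature k) : ℝ) : ℂ) ∂(wilsonMeasure r.ρ b : MeasureTheory.Measure (GaugeConfig 4 (sch.side k) G)))) → ∀ (D : ℕ → SchwartzMap (Fin 2 → EuclideanSpace ℝ (Fin 4)) ℂ → ℂ), (D = fun (k : ℕ) (F : SchwartzMap (Fin 2 → EuclideanSpace ℝ (Fin 4)) ℂ) => ((sch.c r.curvature k * sch.a k ^ 4 : ℝ) : ℂ) * deriv (fun b : ℝ => LSb k 2 F b) (sch.β k)) → (∀ k : ℕ, sch.m r.curvature k = ∫ U, r.curvature.F (torusLift (sch.side k) U) ∂(wilsonMeasure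 r.ρ (sch.β k) : MeasureTheory.Measure (GaugeConfig 4 (sch.side k) G))) → (∃ (s : ℕ) (α β : ℝ), ∀ (n : ℕ) (F : SchwartzMap (Fin n → EuclideanSpace ℝ (Fin 4)) ℂ), IsOffDiagonal F → ∀ᶠ k in Filter.atTop, ‖LS k n F‖ ≤ α * (n.factorial : ℝ) ^ β * schwartzNorm (n * s) F) → (∃ (f g : SchwartzMap (Fin 1 → EuclideanSpace ℝ (Fin 4)) ℂ) (H : SchwartzMap (Fin (1 + 1) → EuclideanSpace ℝ (Fin 4)) ℂ), IsTimeOrdered f ∧ IsTimeOrdered g ∧ IsAppendTensorOf H (osAdjoint f) g ∧ ∃ δ : ℝ, 0 < δ ∧ ∀ᶠ k in Filter.atTop, δ ≤ ‖LS k (1 + 1) H‖) → (∃ Δ : ℝ, 0 < Δ ∧ ∀ (n m : ℕ) (F : SchwartzMap (Fin n → EuclideanSpace ℝ (Fin 4)) ℂ) (G' : SchwartzMap (Fin m → EuclideanSpace ℝ (Fin 4)) ℂ), IsTimeOrdered F → IsTimeOrdered G' → ∃ C : ℝ, ∀ v : EuclideanSpace ℝ (Fin 4), 0 ≤ v 0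 → ∀ᶠ k in Filter.atTop, ∀ H : SchwartzMap (Fin (n + m) → EuclideanSpace ℝ (Fin 4)) ℂ, IsAppendTensorOf H (osAdjoint F) (translateMulti v G') → ‖LS k (n + m) H - LS k n (osAdjoint F) * LS k m G'‖ ≤ C * Real.exp (-Δ * ‖v‖)) → Filter.Tendsto sch.β Filter.atTop Filter.atTop → (∀ (f g : SchwartzMap (EuclideanSpace ℝ (Fin 4)) ℂ) (F₂ : SchwartzMap (Fin 2 → EuclideanSpace ℝ (Fin 4)) ℂ), IsTensorOf F₂ ![f, g] → IsOffDiagonal F₂ → HasCompactSupport ⇑f → HasCompactSupport ⇑g → ∀ ε : ℝ, 0 < ε → ∃ R : ℝ, ∀ᶠ k in Filter.atTop, ∀ (h : SchwartzMap (EuclideanSpace ℝ (Fin 4)) ℂ) (H : SchwartzMap (Fin 3 → EuclideanSpace ℝ (Fin 4)) ℂ), IsTensorOf H ![f, g, h] → (∀ x, ‖x‖ ≤ R → h x = 0) → (∀ x, ‖h x‖ ≤ 1) → ‖LS k 3 H‖ ≤ ε) → ∀ (f g : SchwartzMap (EuclideanSpace ℝ (Fin 4)) ℂ) (F₂ : SchwartzMap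 (Fin 2 → EuclideanSpace ℝ (Fin 4)) ℂ), IsTensorOf F₂ ![f, g] → IsOffDiagonal F₂ → HasCompactSupport ⇑f → HasCompactSupport ⇑g → ∀ ε : ℝ, 0 < ε → ∀ R₀ : ℝ, ∃ R : ℝ, R₀ ≤ R ∧ ∃ (χ : SchwartzMap (EuclideanSpace ℝ (Fin 4)) ℂ) (Hχ : SchwartzMap (Fin 3 → EuclideanSpace ℝ (Fin 4)) ℂ), IsTensorOf Hχ ![f, g, χ] ∧ (∀ x : EuclideanSpace ℝ (Fin 4), ‖x‖ ≤ R → χ x = 1) ∧ ∀ᶠ k in Filter.atTop, ‖D k F₂ - LS k 3 Hχ‖ ≤ ε := by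
  sorry

/-- Registered stub = obligation `ContactLocality` (OPEN). -/
theorem ContactLocality : open Literature.MathematicalPhysics.QuantumFieldTheory Literature.MathematicalPhysics.QuantumLattice Literature.MathematicalPhysics.AQFT Literature.Probability.LatticeModels in ∀ (G : Type) [Group G] [TopologicalSpace G] [IsTopologicalGroup G] [CompactSpace G] [MeasurableSpace G] [BorelSpace G], IsCompactSimpleLieGroup G → ∀ (r : LatticeRep G) (sch : SpeciesScheme (YMSpecies G)) (LS : (k n : ℕ) → SchwartzMap (Fin n → EuclideanSpace ℝ (Fin 4)) ℂ → ℂ), (LS = fun (k n : ℕ) (F : SchwartzMap (Fin n → EuclideanSpace ℝ (Fin 4)) ℂ) => (∫ U, ∑ x : Fin n → ↥(box 4 (sch.L k)), F (fun i => sch.a k • siteToE ↑(x i)) * ∏ i, ((sch.c r.curvature k * sch.a k ^ 4 * (r.curvature.F (configShift (-↑(x i)) (torusLift (sch.side k) U)) - sch.m r.curvature k) : ℝ) : ℂ) ∂(wilsonMeasure r.ρ (sch.β k) : MeasureTheory.Measure (GaugeConfig 4 (sch.side k) G)))) → (∀ k : ℕ, sch.m r.curvature k = ∫ U, r.curvature.F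 (torusLift (sch.side k) U) ∂(wilsonMeasure r.ρ (sch.β k) : MeasureTheory.Measure (GaugeConfig 4 (sch.side k) G))) → (∃ (s : ℕ) (α β : ℝ), ∀ (n : ℕ) (F : SchwartzMap (Fin n → EuclideanSpace ℝ (Fin 4)) ℂ), IsOffDiagonal F → ∀ᶠ k in Filter.atTop, ‖LS k n F‖ ≤ α * (n.factorial : ℝ) ^ β * schwartzNorm (n * s) F) → (∃ (f g : SchwartzMap (Fin 1 → EuclideanSpace ℝ (Fin 4)) ℂ) (H : SchwartzMap (Fin (1 + 1) → EuclideanSpace ℝ (Fin 4)) ℂ), IsTimeOrdered f ∧ IsTimeOrdered g ∧ IsAppendTensorOf H (osAdjoint f) g ∧ ∃ δ : ℝ, 0 < δ ∧ ∀ᶠ k in Filter.atTop, δ ≤ ‖LS k (1 + 1) H‖) → (∃ Δ : ℝ, 0 < Δ ∧ ∀ (n m : ℕ) (F : SchwartzMap (Fin n → EuclideanSpace ℝ (Fin 4)) ℂ) (G' : SchwartzMap (Fin m → EuclideanSpace ℝ (Fin 4)) ℂ), IsTimeOrdered F → IsTimeOrdered G' → ∃ C : ℝ, ∀ v : EuclideanSpace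 ℝ (Fin 4), 0 ≤ v 0 → ∀ᶠ k in Filter.atTop, ∀ H : SchwartzMap (Fin (n + m) → EuclideanSpace ℝ (Fin 4)) ℂ, IsAppendTensorOf H (osAdjoint F) (translateMulti v G') → ‖LS k (n + m) H - LS k n (osAdjoint F) * LS k m G'‖ ≤ C * Real.exp (-Δ * ‖v‖)) → Filter.Tendsto sch.β Filter.atTop Filter.atTop → ∃ d : ℝ → ℕ → ℂ, ∀ (f g : SchwartzMap (EuclideanSpace ℝ (Fin 4)) ℂ) (F₂ : SchwartzMap (Fin 2 → EuclideanSpace ℝ (Fin 4)) ℂ), IsTensorOf F₂ ![f, g] → IsOffDiagonal F₂ → HasCompactSupport ⇑f → HasCompactSupport ⇑g → ∀ (R : ℝ) (χ : SchwartzMap (EuclideanSpace ℝ (Fin 4)) ℂ) (Hχ : SchwartzMap (Fin 3 → EuclideanSpace ℝ (Fin 4)) ℂ), IsTensorOf Hχ ![f, g, χ] → (∀ x : EuclideanSpace ℝ (Fin 4), ‖x‖ ≤ R → χ x = 1) → tsupport ⇑f ∪ tsupport ⇑g ⊆ Metric.ball (0 : EuclideanSpace ℝ (Fin 4)) R → ∀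 ε : ℝ, 0 < ε → ∃ ρ₀ : ℝ, 0 < ρ₀ ∧ ∀ ρ : ℝ, 0 < ρ → ρ < ρ₀ → ∃ (N : ℕ) (H' : Fin N → SchwartzMap (Fin 3 → EuclideanSpace ℝ (Fin 4)) ℂ), (∀ j, ∃ (f' g' h' : SchwartzMap (EuclideanSpace ℝ (Fin 4)) ℂ), IsTensorOf (H' j) ![f', g', h'] ∧ IsOffDiagonal (H' j)) ∧ ∀ᶠ k in Filter.atTop, ‖LS k 3 Hχ - ∑ j, LS k 3 (H' j) - d ρ k * LS k 2 F₂‖ ≤ ε := by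
  sorry

/-- Registered stub = obligation `CouplingDerivativeIsDilation` (OPEN). -/
theorem CouplingDerivativeIsDilation : open Literature.MathematicalPhysics.QuantumFieldTheory Literature.MathematicalPhysics.QuantumLattice Literature.MathematicalPhysics.AQFT Literature.Probability.LatticeModels in ∀ (G : Type) [Group G] [TopologicalSpace G] [IsTopologicalGroup G] [CompactSpace G] [MeasurableSpace G] [BorelSpace G], IsCompactSimpleLieGroup G → ∀ (r : LatticeRep G) (sch : SpeciesScheme (YMSpecies G)) (LS : (k n : ℕ) → SchwartzMap (Fin n → EuclideanSpace ℝ (Fin 4)) ℂ → ℂ), (LS = fun (k n : ℕ) (F : SchwartzMap (Fin n → EuclideanSpace ℝ (Fin 4)) ℂ) => (∫ U, ∑ x : Fin n → ↥(box 4 (sch.L k)), F (fun i => sch.a k • siteToE ↑(x i)) * ∏ i, ((sch.c r.curvature k * sch.a k ^ 4 * (r.curvature.F (configShift (-↑(x i)) (torusLift (sch.side k) U)) - sch.m r.curvature k) : ℝ) : ℂ) ∂(wilsonMeasure r.ρ (sch.β k) : MeasureTheory.Measure (GaugeConfig 4 (sch.side k) G)))) → ∀ (LSb : (k n : ℕ)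 → SchwartzMap (Fin n → EuclideanSpace ℝ (Fin 4)) ℂ → ℝ → ℂ), (LSb = fun (k n : ℕ) (F : SchwartzMap (Fin n → EuclideanSpace ℝ (Fin 4)) ℂ) (b : ℝ) => (∫ U, ∑ x : Fin n → ↥(box 4 (sch.L k)), F (fun i => sch.a k • siteToE ↑(x i)) * ∏ i, ((sch.c r.curvature k * sch.a k ^ 4 * (r.curvature.F (configShift (-↑(x i)) (torusLift (sch.side k) U)) - sch.m r.curvature k) : ℝ) : ℂ) ∂(wilsonMeasure r.ρ b : MeasureTheory.Measure (GaugeConfig 4 (sch.side k) G)))) → ∀ (D : ℕ → SchwartzMap (Fin 2 → EuclideanSpace ℝ (Fin 4)) ℂ → ℂ), (D = fun (k : ℕ) (F : SchwartzMap (Fin 2 → EuclideanSpace ℝ (Fin 4)) ℂ) => ((sch.c r.curvature k * sch.a k ^ 4 : ℝ) : ℂ) * deriv (fun b : ℝ => LSb k 2 F b) (sch.β k)) → (∀ k : ℕ, sch.m r.curvature k = ∫ U, r.curvature.F (torusLift (sch.side k) U) ∂(wilsonMeasure r.ρ (sch.β k) : MeasureTheory.Measure (GaugeConfig 4 (sch.side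 k) G))) → (∃ (s : ℕ) (α β : ℝ), ∀ (n : ℕ) (F : SchwartzMap (Fin n → EuclideanSpace ℝ (Fin 4)) ℂ), IsOffDiagonal F → ∀ᶠ k in Filter.atTop, ‖LS k n F‖ ≤ α * (n.factorial : ℝ) ^ β * schwartzNorm (n * s) F) → (∃ (f g : SchwartzMap (Fin 1 → EuclideanSpace ℝ (Fin 4)) ℂ) (H : SchwartzMap (Fin (1 + 1) → EuclideanSpace ℝ (Fin 4)) ℂ), IsTimeOrdered f ∧ IsTimeOrdered g ∧ IsAppendTensorOf H (osAdjoint f) g ∧ ∃ δ : ℝ, 0 < δ ∧ ∀ᶠ k in Filter.atTop, δ ≤ ‖LS k (1 + 1) H‖) → (∃ Δ : ℝ, 0 < Δ ∧ ∀ (n m : ℕ) (F : SchwartzMap (Fin n → EuclideanSpace ℝ (Fin 4)) ℂ) (G' : SchwartzMap (Fin m → EuclideanSpace ℝ (Fin 4)) ℂ), IsTimeOrdered F → IsTimeOrdered G' → ∃ C : ℝ, ∀ v : EuclideanSpace ℝ (Fin 4), 0 ≤ v 0 → ∀ᶠ k in Filter.atTop, ∀ H : SchwartzMap (Fin (n +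 m) → EuclideanSpace ℝ (Fin 4)) ℂ, IsAppendTensorOf H (osAdjoint F) (translateMulti v G') → ‖LS k (n + m) H - LS k n (osAdjoint F) * LS k m G'‖ ≤ C * Real.exp (-Δ * ‖v‖)) → Filter.Tendsto sch.β Filter.atTop Filter.atTop → ∃ κ κ' : ℕ → ℂ, (∃ κ₀ : ℝ, 0 < κ₀ ∧ ∀ᶠ k in Filter.atTop, κ₀ ≤ ‖κ k‖) ∧ ∀ (f g : SchwartzMap (EuclideanSpace ℝ (Fin 4)) ℂ) (F₂ Fd : SchwartzMap (Fin 2 → EuclideanSpace ℝ (Fin 4)) ℂ), IsTensorOf F₂ ![f, g] → IsOffDiagonal F₂ → HasCompactSupport ⇑f → HasCompactSupport ⇑g → (∀ x, Fd x = -8 * F₂ x - fderiv ℝ (⇑F₂) x x) → Filter.Tendsto (fun k : ℕ => D k F₂ - κ k * LS k 2 Fd - κ' k * LS k 2 F₂) Filter.atTop (nhds 0) := by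
  sorry

/-- Registered stub = obligation `TwoPointNotHomogeneous` (PROVABLE-grade). -/
theorem TwoPointNotHomogeneous : open Literature.MathematicalPhysics.QuantumFieldTheory Literature.MathematicalPhysics.QuantumLattice Literature.MathematicalPhysics.AQFT Literature.Probability.LatticeModels in ∀ (G : Type) [Group G] [TopologicalSpace G] [IsTopologicalGroup G] [CompactSpace G] [MeasurableSpace G] [BorelSpace G], IsCompactSimpleLieGroup G → ∀ (r : LatticeRep G) (sch : SpeciesScheme (YMSpecies G)) (LS : (k n : ℕ) → SchwartzMap (Fin n → EuclideanSpace ℝ (Fin 4)) ℂ → ℂ), (LS = fun (k n : ℕ) (F : SchwartzMap (Fin n → EuclideanSpace ℝ (Fin 4)) ℂ) => (∫ U, ∑ x : Fin n → ↥(box 4 (sch.L k)), F (fun i => sch.a k • siteToE ↑(x i)) * ∏ i, ((sch.c r.curvature k * sch.a k ^ 4 * (r.curvature.F (configShift (-↑(x i)) (torusLift (sch.side k) U)) - sch.m r.curvature k) : ℝ) : ℂ) ∂(wilsonMeasure r.ρ (sch.β k) : MeasureTheory.Measure (GaugeConfig 4 (sch.side k) G)))) → (∀ k : ℕ, sch.m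 r.curvature k = ∫ U, r.curvature.F (torusLift (sch.side k) U) ∂(wilsonMeasure r.ρ (sch.β k) : MeasureTheory.Measure (GaugeConfig 4 (sch.side k) G))) → (∃ (s : ℕ) (α β : ℝ), ∀ (n : ℕ) (F : SchwartzMap (Fin n → EuclideanSpace ℝ (Fin 4)) ℂ), IsOffDiagonal F → ∀ᶠ k in Filter.atTop, ‖LS k n F‖ ≤ α * (n.factorial : ℝ) ^ β * schwartzNorm (n * s) F) → (∃ (f g : SchwartzMap (Fin 1 → EuclideanSpace ℝ (Fin 4)) ℂ) (H : SchwartzMap (Fin (1 + 1) → EuclideanSpace ℝ (Fin 4)) ℂ), IsTimeOrdered f ∧ IsTimeOrdered g ∧ IsAppendTensorOf H (osAdjoint f) g ∧ ∃ δ : ℝ, 0 < δ ∧ ∀ᶠ k in Filter.atTop, δ ≤ ‖LS k (1 + 1) H‖) → (∃ Δ : ℝ, 0 < Δ ∧ ∀ (n m : ℕ) (F : SchwartzMap (Fin n → EuclideanSpace ℝ (Fin 4)) ℂ) (G' : SchwartzMap (Fin m → EuclideanSpace ℝ (Fin 4)) ℂ), IsTimeOrdered F → IsTimeOrdered G' →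 ∃ C : ℝ, ∀ v : EuclideanSpace ℝ (Fin 4), 0 ≤ v 0 → ∀ᶠ k in Filter.atTop, ∀ H : SchwartzMap (Fin (n + m) → EuclideanSpace ℝ (Fin 4)) ℂ, IsAppendTensorOf H (osAdjoint F) (translateMulti v G') → ‖LS k (n + m) H - LS k n (osAdjoint F) * LS k m G'‖ ≤ C * Real.exp (-Δ * ‖v‖)) → ∃ (f₁ g₁ f₂ g₂ : SchwartzMap (EuclideanSpace ℝ (Fin 4)) ℂ) (F₁ F₂ Fd₁ Fd₂ : SchwartzMap (Fin 2 → EuclideanSpace ℝ (Fin 4)) ℂ), IsTensorOf F₁ ![f₁, g₁] ∧ IsTensorOf F₂ ![f₂, g₂] ∧ IsOffDiagonal F₁ ∧ IsOffDiagonal F₂ ∧ HasCompactSupport ⇑f₁ ∧ HasCompactSupport ⇑g₁ ∧ HasCompactSupport ⇑f₂ ∧ HasCompactSupport ⇑g₂ ∧ (∀ x, Fd₁ x = -8 * F₁ x - fderiv ℝ (⇑F₁) x x) ∧ (∀ x, Fd₂ x = -8 * F₂ x - fderiv ℝ (⇑F₂) x x) ∧ ∃ δ' M : ℝ, 0 <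 δ' ∧ (∀ᶠ k in Filter.atTop, ‖LS k 2 F₁‖ ≤ M ∧ ‖LS k 2 F₂‖ ≤ M) ∧ ∃ᶠ k in Filter.atTop, δ' ≤ ‖LS k 2 Fd₁ * LS k 2 F₂ - LS k 2 Fd₂ * LS k 2 F₁‖ := by
  sorry

/-- Registered stub = obligation `UniformClusteringAlongAF` (OPEN). -/
theorem UniformClusteringAlongAF : open Literature.MathematicalPhysics.QuantumFieldTheory Literature.MathematicalPhysics.QuantumLattice Literature.MathematicalPhysics.AQFT Literature.Probability.LatticeModels in ∀ (G : Type) [Group G] [TopologicalSpace G] [IsTopologicalGroup G] [CompactSpace G] [MeasurableSpace G] [BorelSpace G], IsCompactSimpleLieGroup G → ∀ (r : LatticeRep G) (sch : SpeciesScheme (YMSpecies G)) (LS : (k n : ℕ) → SchwartzMap (Fin n → EuclideanSpace ℝ (Fin 4)) ℂ → ℂ), (LS = fun (k n : ℕ) (F : SchwartzMap (Fin n → EuclideanSpace ℝ (Fin 4)) ℂ) => (∫ U, ∑ x : Fin n → ↥(box 4 (sch.L k)), F (fun i => sch.a k • siteToE ↑(x i)) * ∏ i, ((sch.c r.curvature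 k * sch.a k ^ 4 * (r.curvature.F (configShift (-↑(x i)) (torusLift (sch.side k) U)) - sch.m r.curvature k) : ℝ) : ℂ) ∂(wilsonMeasure r.ρ (sch.β k) : MeasureTheory.Measure (GaugeConfig 4 (sch.side k) G)))) → (∀ k : ℕ, sch.m r.curvature k = ∫ U, r.curvature.F (torusLift (sch.side k) U) ∂(wilsonMeasure r.ρ (sch.β k) : MeasureTheory.Measure (GaugeConfig 4 (sch.side k) G))) → (∃ (s : ℕ) (α β : ℝ), ∀ (n : ℕ) (F : SchwartzMap (Fin n → EuclideanSpace ℝ (Fin 4)) ℂ), IsOffDiagonal F → ∀ᶠ k in Filter.atTop, ‖LS k n F‖ ≤ α * (n.factorial : ℝ) ^ β * schwartzNorm (n * s) F) → (∃ (f g : SchwartzMap (Fin 1 → EuclideanSpace ℝ (Fin 4)) ℂ) (H : SchwartzMap (Fin (1 + 1) → EuclideanSpace ℝ (Fin 4)) ℂ), IsTimeOrdered f ∧ IsTimeOrdered g ∧ IsAppendTensorOf H (osAdjoint f) g ∧ ∃ δ : ℝ, 0 < δ ∧ ∀ᶠ k in Filter.atTop, δ ≤ ‖LS k (1 + 1)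 H‖) → (∃ Δ : ℝ, 0 < Δ ∧ ∀ (n m : ℕ) (F : SchwartzMap (Fin n → EuclideanSpace ℝ (Fin 4)) ℂ) (G' : SchwartzMap (Fin m → EuclideanSpace ℝ (Fin 4)) ℂ), IsTimeOrdered F → IsTimeOrdered G' → ∃ C : ℝ, ∀ v : EuclideanSpace ℝ (Fin 4), 0 ≤ v 0 → ∀ᶠ k in Filter.atTop, ∀ H : SchwartzMap (Fin (n + m) → EuclideanSpace ℝ (Fin 4)) ℂ, IsAppendTensorOf H (osAdjoint F) (translateMulti v G') → ‖LS k (n + m) H - LS k n (osAdjoint F) * LS k m G'‖ ≤ C * Real.exp (-Δ * ‖v‖)) → Filter.Tendsto sch.β Filter.atTop Filter.atTop → (∀ (f g : SchwartzMap (EuclideanSpace ℝ (Fin 4)) ℂ) (F₂ : SchwartzMap (Fin 2 → EuclideanSpace ℝ (Fin 4)) ℂ), IsTensorOf F₂ ![f, g] → IsOffDiagonal F₂ → HasCompactSupport ⇑f → HasCompactSupport ⇑g → ∀ ε : ℝ, 0 < ε → ∃ R : ℝ, ∀ᶠ k in Filter.atTop, ∀ (h : SchwartzMap (EuclideanSpace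 ℝ (Fin 4)) ℂ) (H : SchwartzMap (Fin 3 → EuclideanSpace ℝ (Fin 4)) ℂ), IsTensorOf H ![f, g, h] → (∀ x, ‖x‖ ≤ R → h x = 0) → (∀ x, ‖h x‖ ≤ 1) → ‖LS k 3 H‖ ≤ ε) := by
  sorry

/-- Registered stub = obligation `NonGaussianityOffAF` (OPEN). -/
theorem NonGaussianityOffAF : open Literature.MathematicalPhysics.QuantumFieldTheory Literature.MathematicalPhysics.QuantumLattice Literature.MathematicalPhysics.AQFT Literature.Probability.LatticeModels in ∀ (G : Type) [Group G] [TopologicalSpace G] [IsTopologicalGroup G] [CompactSpace G] [MeasurableSpace G] [BorelSpace G], IsCompactSimpleLieGroup G → ∀ (r : LatticeRep G) (sch : SpeciesScheme (YMSpecies G)) (LS : (k n : ℕ) → SchwartzMap (Fin n → EuclideanSpace ℝ (Fin 4)) ℂ → ℂ), (LS = fun (k n : ℕ) (F : SchwartzMap (Fin n → EuclideanSpace ℝ (Fin 4)) ℂ) => (∫ U, ∑ x : Fin n → ↥(box 4 (sch.L k)), F (fun i => sch.a k • siteToE ↑(x i)) * ∏ i, ((sch.c r.curvature k * sch.a k ^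 4 * (r.curvature.F (configShift (-↑(x i)) (torusLift (sch.side k) U)) - sch.m r.curvature k) : ℝ) : ℂ) ∂(wilsonMeasure r.ρ (sch.β k) : MeasureTheory.Measure (GaugeConfig 4 (sch.side k) G)))) → (∀ k : ℕ, sch.m r.curvature k = ∫ U, r.curvature.F (torusLift (sch.side k) U) ∂(wilsonMeasure r.ρ (sch.β k) : MeasureTheory.Measure (GaugeConfig 4 (sch.side k) G))) → (∃ (s : ℕ) (α β : ℝ), ∀ (n : ℕ) (F : SchwartzMap (Fin n → EuclideanSpace ℝ (Fin 4)) ℂ), IsOffDiagonal F → ∀ᶠ k in Filter.atTop, ‖LS k n F‖ ≤ α * (n.factorial : ℝ) ^ β * schwartzNorm (n * s) F) → (∃ (f g : SchwartzMap (Fin 1 → EuclideanSpace ℝ (Fin 4)) ℂ) (H : SchwartzMap (Fin (1 + 1) → EuclideanSpace ℝ (Fin 4)) ℂ), IsTimeOrdered f ∧ IsTimeOrdered g ∧ IsAppendTensorOf H (osAdjoint f) g ∧ ∃ δ : ℝ, 0 < δ ∧ ∀ᶠ k in Filter.atTop, δ ≤ ‖LS k (1 + 1) H‖) → (∃ Δ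 : ℝ, 0 < Δ ∧ ∀ (n m : ℕ) (F : SchwartzMap (Fin n → EuclideanSpace ℝ (Fin 4)) ℂ) (G' : SchwartzMap (Fin m → EuclideanSpace ℝ (Fin 4)) ℂ), IsTimeOrdered F → IsTimeOrdered G' → ∃ C : ℝ, ∀ v : EuclideanSpace ℝ (Fin 4), 0 ≤ v 0 → ∀ᶠ k in Filter.atTop, ∀ H : SchwartzMap (Fin (n + m) → EuclideanSpace ℝ (Fin 4)) ℂ, IsAppendTensorOf H (osAdjoint F) (translateMulti v G') → ‖LS k (n + m) H - LS k n (osAdjoint F) * LS k m G'‖ ≤ C * Real.exp (-Δ * ‖v‖)) → ¬ Filter.Tendsto sch.β Filter.atTop Filter.atTop → ∃ (f g h : SchwartzMap (EuclideanSpace ℝ (Fin 4)) ℂ) (F₃ : SchwartzMap (Fin 3 → EuclideanSpace ℝ (Fin 4)) ℂ), IsTensorOf F₃ ![f, g, h] ∧ IsOffDiagonal F₃ ∧ ∃ δ : ℝ, 0 < δ ∧ ∃ᶠ k in Filter.atTop, δ ≤ ‖LS k 3 F₃‖ := by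
  sorry

end Stub

/-! ## §4 Compositions per piece (sorry-free) -/

/-- A ⇐ A1 ∧ A2 (triangle inequality through the plateau functional; supports in a ball by compactness). [folklore] -/
theorem AnomalyInsertionLocality_of (h₁ : InsertionIdentityFar) (h₂ : ContactLocality) : AnomalyInsertionLocality := by
  intro G _ _ _ _ hG r sch μ LS LSb D hVS hUVB hND hCL hAF hUC
  letI : MeasurableSpace G := borel G
  haveI : BorelSpace G := ⟨rfl⟩
  exact locality_assembly (E := EuclideanSpace ℝ (Fin 4))
    (Supp := fun f : SchwartzMap (EuclideanSpace ℝ (Fin 4)) ℂ => tsupport ⇑f)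
    (Plateau := fun (χ : SchwartzMap (EuclideanSpace ℝ (Fin 4)) ℂ) (R : ℝ) => ∀ x : EuclideanSpace ℝ (Fin 4), ‖x‖ ≤ R → χ x = 1)
    (fun f g hf hg => (hf.isCompact.union hg.isCompact).isBounded.subset_ball 0)
    (h₁ G hG r sch LS rfl LSb rfl D rfl hVS hUVB hND hCL hAF hUC) (h₂ G hG r sch LS rfl hVS hUVB hND hCL hAF)

/-- B ⇐ B1 ∧ B2 (`transmutation_assembly`). [folklore] -/
theorem CouplingDerivativeTransmutation_of (h₁ : CouplingDerivativeIsDilation) (h₂ : TwoPointNotHomogeneous) : CouplingDerivativeTransmutation := by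
  intro G _ _ _ _ hG r sch μ LS LSb D hVS hUVB hND hCL hAF
  letI : MeasurableSpace G := borel G
  haveI : BorelSpace G := ⟨rfl⟩
  obtain ⟨κ, κ', ⟨κ₀, hκ₀, hκev⟩, hrun⟩ := h₁ G hG r sch LS rfl LSb rfl D rfl hVS hUVB hND hCL hAF
  obtain ⟨f₁, g₁, f₂, g₂, F₁, F₂, Fd₁, Fd₂, hT₁, hT₂, hO₁, hO₂, hf₁, hg₁, hf₂, hg₂, hFd₁, hFd₂, δ', M, hδ', hM,
    hdet⟩ := h₂ G hG r sch LS rfl hVS hUVB hND hCL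
  obtain ⟨δ, hδ, hB⟩ := transmutation_assembly (W := fun k F => LS k 2 F) (D := D) hκ₀ hδ' hκev hM hdet
    (hrun f₁ g₁ F₁ Fd₁ hT₁ hO₁ hf₁ hg₁ hFd₁) (hrun f₂ g₂ F₂ Fd₂ hT₂ hO₂ hf₂ hg₂ hFd₂)
  exact ⟨f₁, g₁, f₂, g₂, F₁, F₂, hT₁, hT₂, hO₁, hO₂, hf₁, hg₁, hf₂, hg₂, δ, hδ, hB⟩

/-- C ⇐ C1 ∧ C2 (by cases on asymptotic freedom). [folklore] -/
theorem NonGaussianityOffScaling_of (h₁ : UniformClusteringAlongAF) (h₂ : NonGaussianityOffAF) : NonGaussianityOffScaling := by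
  intro G _ _ _ _ hG r sch μ LS hVS hUVB hND hCL hbad
  letI : MeasurableSpace G := borel G
  haveI : BorelSpace G := ⟨rfl⟩
  by_cases hAF : Filter.Tendsto sch.β Filter.atTop Filter.atTop
  · exact (hbad ⟨hAF, h₁ G hG r sch LS rfl hVS hUVB hND hCL hAF⟩).elim
  · exact h₂ G hG r sch LS rfl hVS hUVB hND hCL hAF

/-! ## §5 The line's composition: the six obligations imply the crux BY NAME -/

/-- **Composition**: `InsertionIdentityFar → ContactLocality → CouplingDerivativeIsDilation → TwoPointNotHomogeneous →
UniformClusteringAlongAF → NonGaussianityOffAF → CurvatureNonGaussianity` — the pieces A, B, C from §4, then the glue: fix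
`G, r, sch` and the four hypotheses, cases on the regime, `anomaly_dichotomy` in the good one. [folklore] -/
theorem CurvatureNonGaussianity_of (h₁ : InsertionIdentityFar) (h₂ : ContactLocality) (h₃ : CouplingDerivativeIsDilation)
    (h₄ : TwoPointNotHomogeneous) (h₅ : UniformClusteringAlongAF) (h₆ : NonGaussianityOffAF) :
    Summit.QuantumFields.YangMills.Theses.FlowLineStateSpace.CurvatureNonGaussianity := by
  have hA : AnomalyInsertionLocality := AnomalyInsertionLocality_of h₁ h₂
  have hB : CouplingDerivativeTransmutation := CouplingDerivativeTransmutation_of h₃ h₄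
  have hC : NonGaussianityOffScaling := NonGaussianityOffScaling_of h₅ h₆
  intro G _ _ _ _ hG r sch μ LS hVS hUVB hND hCL
  refine (Classical.em _).elim (fun hgood => ?_) (fun hbad => hC G hG r sch hVS hUVB hND hCL hbad)
  exact anomaly_dichotomy (hA G hG r sch hVS hUVB hND hCL hgood.1 hgood.2)
    (hB G hG r sch hVS hUVB hND hCL hgood.1)

/-- The line closes the crux modulo its six registered stubs. [folklore] -/
theorem CurvatureNonGaussianity_proof : Summit.QuantumFields.YangMills.Theses.FlowLineStateSpace.CurvatureNonGaussianity :=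
  CurvatureNonGaussianity_of Stub.InsertionIdentityFar Stub.ContactLocality Stub.CouplingDerivativeIsDilation
    Stub.TwoPointNotHomogeneous Stub.UniformClusteringAlongAF Stub.NonGaussianityOffAF

end Summit.QuantumFields.YangMills.Cruxes.CurvatureNonGaussianity.AnomalySplit
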